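import Literature.Computability.Complexity.GF2StringArith
import Literature.Computability.Complexity.MildHardLanguage
import Literature.Computability.Complexity.NWQuickPRG
import Literature.Computability.Complexity.LengthCompare
import Literature.Computability.Complexity.ExpPadding
import HarnessLib

/-!
# The mildly hard language is in `E`: the machine (Arora–Barak 2009, proof of Thm. 19.21)

The computational half of the first step of hardness amplification inside `E`
(Babai–Fortnow–Nisan–Wigderson 1993, §4; Arora–Barak 2009, Thm. 19.21: "the function `g` is
computable in `E` since `E` is closed under such encodings"): the explicit language
`MildHard.hardLang L` of `MildHardLanguage.lean` — the bits of the low-degree extension over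
`GF(2^{M+1})` of `L ∩ {0,1}ⁿ` — is in `E` whenever `L ∈ E`, and hence (**`exists_mildHard_E`**)
worst-case hardness `2^{εn}` almost everywhere in `E` gives mild average-case hardness almost
everywhere in `E` (`MildHard.mild_of_worst` supplies the circuit side).

The machine is written in the tree's `FP` brick algebra (`BrickAlgebra`, `FoldBricks`: counted folds
`foldLoop op piece` with model `foldAcc`), level by level, each brick with its `FP` membership and
its value on genuine inputs identified with the string-level model of `GF2StringArith.lean`:

* B1–B4 (field arithmetic on `M+1`-bit strings): `xorF` (`xorStr`), `clmulF` (carry-less product,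
  `clmulFold`), `pmodF` (remainder modulo a monic modulus by Horner's rule, `pmodStr`), `fmulOpF`
  (multiplication modulo `f`), `finvF` (inversion `u^{2^{M+1}-2}` by the squaring chain `invOpF`);
  `clipOp` enforces the additive growth law of `foldLoop` on every input;
* B5 (the modulus): `irredF` (trial division by every bitmask in `[2, 2^{M+1})`, `irredFull`) and
  `modSearchF` (first irreducible bitmask = `canonIrredBits M`, `modSearch_eq`), the pad paying for
  the `2^{M+1}` rounds;
* B6–B8 (the extension): `deltaF` (Lagrange indicator `δ_c(t)`, `deltaStr`), `termF`
  (`∏_i δ_{a_i}(z_i)`, windows advanced by `termOpF`), `extF` (xor-accumulate over all `2ⁿ` cube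
  points, membership in `L` answered by the clocked universal machine `NWMachine.evalF` with the code
  of an `E`-machine for `L`, `NWMachine.exists_run_of_mem_E`; value `bits M (SelfCorrect.ext (cubeFnOf G) z)`);
* B9–B11 (the language): `padT`/`restT` (parsing the padded input `1^{2^{|x|}} 0 x`), `etaOfF`
  (the scale `etaOf |x|` by a keep-last fold), the parameter bricks `cEta … cValid`, the one-hot
  selection `onesCountF`/`selF`, **`coreF_apply`**: `coreF ⟨x, 1ᴺ⟩ = [hardBit L x]`; the padded
  language `hardLangPad ∈ P` (`mem_P_of_mem_FP`), the padding equivalence `mem_hardLang_iff`, and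
  upward translation (`ExpPadding.exists_timeDecidable_of_expPad`, pad `2^{|x|}`):
  **`hardLang_mem_E`**, **`exists_mildHard_E`**.

## References

* S. Arora, B. Barak, *Computational Complexity: A Modern Approach*, CUP 2009, Thm. 19.21 (proof),
  §19.4.2, §2.6.2 (padding) [AroraBarakCC2009].
* L. Babai, L. Fortnow, N. Nisan, A. Wigderson, *BPP has subexponential time simulations unless
  EXPTIME has publishable proofs*, Comput. Complexity 3 (1993) 307–318, §4.
* R. J. McEliece, *The Theory of Information and Coding*, 2nd ed., CUP 2002, Ch. 9 §9.1 [Mceliece2002].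
-/

noncomputable section

namespace Literature.Computability.Complexity

open _root_.Computability Polynomial Brick Plumb GF2Str Literature.InformationTheory.Coding

namespace HardLangM

variable (M : ℕ)

/-! ### Generic bridge: the counted fold is a `List.foldl` over `List.range'` -/

/-- **The counted fold `foldAcc` as a `List.foldl`** over the round numbers, once the operation and the
piece function are identified with models (only on the rounds actually run). [folklore] -/
theorem foldAcc_eq_foldl (op f : List Bool → List Bool) (x : List Bool) (opV : List Bool → List Bool → List Bool)
    (fV : ℕ → List Bool) :
    ∀ (k i : ℕ) (acc : List Bool), (∀ a j, i ≤ j → j < i + k → op (boolPair a (fV j)) = opV a (fV j)) →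
      (∀ j, i ≤ j → j < i + k → f (boolPair x (ones j)) = fV j) →
      foldAcc op f x i k acc = (List.range' i k).foldl (fun acc j => opV acc (fV j)) acc
  | 0, i, acc, _, _ => by simp
  | k + 1, i, acc, hop, hf => by
    rw [foldAcc_succ, List.range'_succ, List.foldl_cons, hf i le_rfl (by omega), hop _ i le_rfl (by omega),
      foldAcc_eq_foldl op f x opV fV k (i + 1) _ (fun a j hj hj' => hop a j (by omega) (by omega))
        (fun j hj hj' => hf j (by omega) (by omega))]

/-! ### B1. Bitwise xor of two strings -/

/-- Xor of two strings of length `≤ 1`: `xorStr u v` (on `⟨u, v⟩`). [folklore] -/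
def xor1F : List Bool → List Bool :=
  iteFn (isNilFn ∘ fstF) sndF (iteFn (isNilFn ∘ sndF) fstF
    (HashBricks.xorFn (HashBricks.headBitFn ∘ fstF) (HashBricks.headBitFn ∘ sndF)))

/-- `xor1F ∈ FP`. [folklore] -/
theorem xor1F_mem_FP : xor1F ∈ FP :=
  iteFn_mem_FP (comp_mem_FP isNilFn_mem_FP fstF_mem_FP) sndF_mem_FP
    (iteFn_mem_FP (comp_mem_FP isNilFn_mem_FP sndF_mem_FP) fstF_mem_FP
      (HashBricks.xorFn_mem_FP (comp_mem_FP HashBricks.headBitFn_mem_FP fstF_mem_FP)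
        (comp_mem_FP HashBricks.headBitFn_mem_FP sndF_mem_FP)))

/-- Value of `xor1F` on strings of length `≤ 1`. [folklore] -/
theorem xor1F_apply (u v : List Bool) (hu : u.length ≤ 1) (hv : v.length ≤ 1) : xor1F (boolPair u v) = xorStr u v := by
  unfold xor1F
  by_cases hun : u = []
  · subst hun
    rw [iteFn_apply_true (by simp [isNilFn])]
    simp
  · rw [iteFn_apply_false (by simp [isNilFn, hun])]
    by_cases hvn : v = []
    · subst hvn
      rw [iteFn_apply_true (by simp [isNilFn])]
      simp
    · rw [iteFn_apply_false (by simp [isNilFn, hvn])]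
      match u, v, hu, hv with
      | [a], [b], _, _ =>
        rw [HashBricks.xorFn_apply (b := a) (b' := b) (by simp) (by simp)]
        rfl

/-- `xor1F` never returns more than one symbol more than its operands (crude total bound). [folklore] -/
theorem length_xor1F_le (w : List Bool) : (xor1F w).length ≤ (fstF w).length + (sndF w).length + 1 := by
  unfold xor1F
  rcases hc : (isNilFn (fstF w)) with _ | ⟨b, _ | _⟩ <;> simp [isNilFn] at hc
  by_cases h1 : fstF w = []
  · rw [iteFn_apply_true (by simp [isNilFn, h1])]; omega
  · rw [iteFn_apply_false (by simp [isNilFn, h1])]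
    by_cases h2 : sndF w = []
    · rw [iteFn_apply_true (by simp [isNilFn, h2])]; omega
    · rw [iteFn_apply_false (by simp [isNilFn, h2])]
      rw [HashBricks.xorFn_apply (b := (fstF w).headD false) (b' := (sndF w).headD false) (by simp) (by simp)]
      simp

/-- The xor piece on `⟨⟨a, b⟩, 1ʲ⟩`: `xorStr a[j] b[j]` (entries as strings of length `≤ 1`). [folklore] -/
def xorPieceF : List Bool → List Bool :=
  xor1F ∘ fanoutFn (bitAtFn ∘ fanoutFn sndF (fstF ∘ fstF)) (bitAtFn ∘ fanoutFn sndF (sndF ∘ fstF))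

/-- `xorPieceF ∈ FP`. [folklore] -/
theorem xorPieceF_mem_FP : xorPieceF ∈ FP :=
  comp_mem_FP xor1F_mem_FP (fanoutFn_mem_FP
    (comp_mem_FP bitAtFn_mem_FP (fanoutFn_mem_FP sndF_mem_FP (comp_mem_FP fstF_mem_FP fstF_mem_FP)))
    (comp_mem_FP bitAtFn_mem_FP (fanoutFn_mem_FP sndF_mem_FP (comp_mem_FP sndF_mem_FP fstF_mem_FP))))

/-- Value of the xor piece. [folklore] -/
theorem xorPieceF_apply (a b : List Bool) (j : ℕ) :
    xorPieceF (boolPair (boolPair a b) (ones j)) = xorStr ((a.drop j).take 1) ((b.drop j).take 1) := by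
  simp only [xorPieceF, Function.comp_apply, fanoutFn_apply, fstF_boolPair, sndF_boolPair, bitAtFn_boolPair, ones,
    List.length_replicate]
  exact xor1F_apply _ _ (List.length_take_le _ _) (List.length_take_le _ _)

/-- The xor piece is short. [folklore] -/
theorem length_xorPieceF_le (z : List Bool) : (xorPieceF z).length ≤ 3 := by
  simp only [xorPieceF, Function.comp_apply, fanoutFn_apply]
  refine (length_xor1F_le _).trans ?_
  simp only [fstF_boolPair, sndF_boolPair, bitAtFn_boolPair]
  have := List.length_take_le 1 ((fstF (fstF z)).drop (sndF z).length)
  have := List.length_take_le 1 ((sndF (fstF z)).drop (sndF z).length)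
  omega

/-- Concatenating the length-`≤ 1` windows of a list rebuilds its prefix. [folklore] -/
theorem ccat_drop_take (l : List Bool) : ∀ n, ccat (fun j => (l.drop j).take 1) n = l.take n
  | 0 => by simp
  | n + 1 => by
    rw [ccat_succ, ccat_drop_take l n]
    by_cases h : n < l.length
    · rw [List.take_one_drop_eq_of_lt_length h, List.take_add_one, List.getElem?_eq_getElem h]
      rfl
    · push Not at h
      rw [List.drop_eq_nil_of_le h, List.take_nil, List.append_nil, List.take_of_length_le h,
        List.take_of_length_le (by omega)]

/-- **`xorStr` entrywise**: concatenating the xors of the entries gives `xorStr`. [folklore] -/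
theorem ccat_xorStr_entries (a b : List Bool) {n : ℕ} (hn : max a.length b.length ≤ n) :
    ccat (fun j => xorStr ((a.drop j).take 1) ((b.drop j).take 1)) n = xorStr a b := by
  have : (fun j => xorStr ((a.drop j).take 1) ((b.drop j).take 1)) = fun j => ((xorStr a b).drop j).take 1 := by
    funext j; rw [xorStr_drop, xorStr_take]
  rw [this, ccat_drop_take, List.take_of_length_le (by rw [length_xorStr]; exact hn)]

/-- **The xor brick** `xorF ⟨a, b⟩ = xorStr a b`: the counted fold of the xor pieces over
`j < |a| + |b|`, concatenated. [folklore] -/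
def xorF : List Bool → List Bool :=
  sndPow 2 ∘ foldLoop appF (clipF 3 xorPieceF) (2 * X) ∘
    fanoutFn (fun w => w) (fanoutFn (lenBinF ∘ appF) fun _ => boolPair [] [])

/-- `xorF ∈ FP`. [folklore] -/
theorem xorF_mem_FP : xorF ∈ FP :=
  comp_mem_FP (sndPow_mem_FP 2) (comp_mem_FP
    (foldLoop_clipF_mem_FP 3 appF_mem_FP length_appF_le xorPieceF_mem_FP _)
    (fanoutFn_mem_FP (PolyTimeComputable.id _)
      (fanoutFn_mem_FP (comp_mem_FP lenBinF_mem_FP appF_mem_FP) (const_mem_FP _))))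

/-- **Value of the xor brick** (total: on the two fields of any string). [folklore] -/
theorem xorF_apply' (w : List Bool) : xorF w = xorStr (fstF w) (sndF w) := by
  have hk : (fstF w ++ sndF w).length ≤ (2 * X : Polynomial ℕ).eval w.length := by
    simp only [eval_mul, eval_ofNat, eval_X, List.length_append]
    have := length_boolUnpair_parts_le w; simp only [fstF, sndF]; omega
  simp only [xorF, Function.comp_apply, fanoutFn_apply, lenBinF_apply, appF]
  rw [show boolPair ([] : List Bool) [] = boolPair (ones 0) [] by rfl,
    foldLoop_apply appF _ hk 0 [], sndPow_succ_boolPair, sndPow_succ_boolPair, sndPow_zero_boolPair,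
    foldAcc_clipF (fun j _ _ => (length_xorPieceF_le _).trans (by omega)), foldAcc_appF]
  simp only [List.nil_append, zero_add]
  have : ∀ j, xorPieceF (boolPair w (ones j)) = xorStr (((fstF w).drop j).take 1) (((sndF w).drop j).take 1) := by
    intro j
    simp only [xorPieceF, Function.comp_apply, fanoutFn_apply, sndF_boolPair, fstF_boolPair, bitAtFn_boolPair, ones,
      List.length_replicate]
    exact xor1F_apply _ _ (List.length_take_le _ _) (List.length_take_le _ _)
  simp only [this]
  exact ccat_xorStr_entries _ _ (by simp)

/-- Value of the xor brick on a pair. [folklore] -/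
theorem xorF_apply (a b : List Bool) : xorF (boolPair a b) = xorStr a b := by
  rw [xorF_apply', fstF_boolPair, sndF_boolPair]

/-- Growth of the xor brick: `|xorF w| ≤ |fstF w| + |sndF w|` (for the fold combinator). [folklore] -/
theorem length_xorF_le (w : List Bool) : (xorF w).length ≤ (fstF w).length + (sndF w).length + 0 := by
  rw [xorF_apply', length_xorStr]; omega

/-! ### B2. Carry-less multiplication -/

/-- **Carry-less multiplication as a fold**: xor the shifted copies `0ⁱ b` of `b` for the set bits
`a_i` (any list with the product polynomial will do downstream, `pmodStr_congr`). [folklore] -/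
def clmulFold (a b : List Bool) : List Bool :=
  (List.range a.length).foldl (fun acc i => xorStr acc (if a.getD i false then List.replicate i false ++ b else [])) []

/-- Prepending `i` zeros multiplies by `Xⁱ`. [folklore] -/
theorem polyOfBits_replicate_append (i : ℕ) (b : List Bool) :
    polyOfBits (List.replicate i false ++ b) = X ^ i * polyOfBits b := by
  induction i with
  | zero => simp
  | succ i ih => rw [List.replicate_succ, List.cons_append, polyOfBits_cons, ih]; simp [pow_succ]; ring

/-- The polynomial of a prefix, one entry more. [folklore] -/
theorem polyOfBits_take_succ (l : List Bool) (n : ℕ) :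
    polyOfBits (l.take (n + 1)) = polyOfBits (l.take n) + Polynomial.C (bitZ (l.getD n false)) * X ^ n := by
  ext i
  simp only [coeff_polyOfBits, coeff_add, coeff_C_mul, coeff_X_pow]
  rw [List.getD_eq_getElem?_getD, List.getD_eq_getElem?_getD, List.getD_eq_getElem?_getD, List.getElem?_take,
    List.getElem?_take]
  by_cases h1 : i < n
  · simp [h1, show i < n + 1 by omega, show i ≠ n by omega]
  · by_cases h2 : i = n
    · subst h2; simp
    · simp [h1, h2, show ¬ i < n + 1 by omega]

/-- **The fold multiplies.** [folklore] -/
theorem polyOfBits_clmulFold (a b : List Bool) : polyOfBits (clmulFold a b) = polyOfBits a * polyOfBits b := by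
  have h : ∀ n, polyOfBits ((List.range n).foldl
      (fun acc i => xorStr acc (if a.getD i false then List.replicate i false ++ b else [])) []) =
      polyOfBits (a.take n) * polyOfBits b := by
    intro n
    induction n with
    | zero => simp
    | succ n ih =>
      rw [List.range_succ, List.foldl_append, List.foldl_cons, List.foldl_nil, polyOfBits_xorStr, ih,
        polyOfBits_take_succ, add_mul]
      congr 1
      cases a.getD n false <;> simp [polyOfBits_replicate_append]
  rw [clmulFold, h, List.take_length]

/-- Length of the fold product: `≤ |a| + |b|`. [folklore] -/
theorem length_clmulFold_le (a b : List Bool) : (clmulFold a b).length ≤ a.length + b.length := by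
  have h : ∀ n, ((List.range n).foldl
      (fun acc i => xorStr acc (if a.getD i false then List.replicate i false ++ b else [])) []).length ≤ n + b.length := by
    intro n
    induction n with
    | zero => simp
    | succ n ih =>
      rw [List.range_succ, List.foldl_append, List.foldl_cons, List.foldl_nil, length_xorStr]
      refine max_le (ih.trans (by omega)) ?_
      split_ifs
      · simp
      · simp
  exact h a.length

/-- The shifted-copy piece on `⟨⟨a, b⟩, 1ⁱ⟩`: `0ⁱ b` if `a_i`, else `[]` (for `i < |a|`). [folklore] -/
def clPieceF : List Bool → List Bool :=
  iteFn (bitAtFn ∘ fanoutFn sndF (fstF ∘ fstF)) (appF ∘ fanoutFn (Kannan.zerosFn ∘ sndF) (sndF ∘ fstF)) fun _ => []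

/-- `clPieceF ∈ FP`. [folklore] -/
theorem clPieceF_mem_FP : clPieceF ∈ FP :=
  iteFn_mem_FP (comp_mem_FP bitAtFn_mem_FP (fanoutFn_mem_FP sndF_mem_FP (comp_mem_FP fstF_mem_FP fstF_mem_FP)))
    (comp_mem_FP appF_mem_FP (fanoutFn_mem_FP (comp_mem_FP Kannan.zerosFn_mem_FP sndF_mem_FP)
      (comp_mem_FP sndF_mem_FP fstF_mem_FP))) (const_mem_FP _)

/-- Value of the piece (`i < |a|`). [folklore] -/
theorem clPieceF_apply (a b : List Bool) {i : ℕ} (hi : i < a.length) :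
    clPieceF (boolPair (boolPair a b) (ones i)) = if a.getD i false then List.replicate i false ++ b else [] := by
  have hc : (bitAtFn ∘ fanoutFn sndF (fstF ∘ fstF)) (boolPair (boolPair a b) (ones i)) = [a.getD i false] := by
    simp only [Function.comp_apply, fanoutFn_apply, sndF_boolPair, fstF_boolPair, bitAtFn_boolPair, ones,
      List.length_replicate]
    rw [List.take_one_drop_eq_of_lt_length hi, List.getD_eq_getElem _ _ hi]
    rfl
  rw [clPieceF, iteFn_apply hc]
  cases a.getD i false <;> simp [ones]

/-- **The carry-less multiplication brick** `clmulF ⟨a, b⟩ = clmulFold a b`. [folklore] -/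
def clmulF : List Bool → List Bool :=
  sndPow 2 ∘ foldLoop xorF (clipF 1 clPieceF) X ∘
    fanoutFn (fun w => w) (fanoutFn (lenBinF ∘ fstF) fun _ => boolPair [] [])

/-- `clmulF ∈ FP`. [folklore] -/
theorem clmulF_mem_FP : clmulF ∈ FP :=
  comp_mem_FP (sndPow_mem_FP 2) (comp_mem_FP
    (foldLoop_clipF_mem_FP 1 xorF_mem_FP length_xorF_le clPieceF_mem_FP _)
    (fanoutFn_mem_FP (PolyTimeComputable.id _)
      (fanoutFn_mem_FP (comp_mem_FP lenBinF_mem_FP fstF_mem_FP) (const_mem_FP _))))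

/-- **Value of the carry-less multiplication brick.** [folklore] -/
theorem clmulF_apply (a b : List Bool) : clmulF (boolPair a b) = clmulFold a b := by
  have hk : a.length ≤ (X : Polynomial ℕ).eval (boolPair a b).length := by
    simp only [eval_X, length_boolPair]; omega
  simp only [clmulF, Function.comp_apply, fanoutFn_apply, lenBinF_apply, fstF_boolPair]
  rw [show boolPair ([] : List Bool) [] = boolPair (ones 0) [] by rfl,
    foldLoop_apply xorF _ hk 0 [], sndPow_succ_boolPair, sndPow_succ_boolPair, sndPow_zero_boolPair,
    foldAcc_clipF (fun j _ hj => ?_)]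
  · -- the fold, as a `List.foldl`; rounds past `|a|` never happen, so the piece model may be anything there
    have hgen : ∀ (k i : ℕ) (acc : List Bool), i + k ≤ a.length → foldAcc xorF clPieceF (boolPair a b) i k acc =
        (List.range' i k).foldl (fun acc j => xorStr acc (if a.getD j false then List.replicate j false ++ b else [])) acc := by
      intro k
      induction k with
      | zero => intro i acc _; simp
      | succ k ih =>
        intro i acc hik
        rw [foldAcc_succ, List.range'_succ, List.foldl_cons, clPieceF_apply a b (by omega), xorF_apply, ih (i + 1) _ (by omega)]
    rw [hgen a.length 0 [] (by omega), clmulFold, List.range_eq_range']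
  · rw [clPieceF_apply a b (by omega)]
    split_ifs
    · simp [length_boolPair]; omega
    · simp

/-! ### B3. Remainder modulo a monic polynomial -/

/-- The remainder depends only on the polynomial of the dividend (modulus of `m + 1` bits, top bit set). [folklore] -/
theorem pmodStr_congr {m : ℕ} {f : List Bool} (hf : f.length = m + 1) (htop : f.getD m false = true)
    {l l' : List Bool} (h : polyOfBits l = polyOfBits l') : pmodStr m f l = pmodStr m f l' :=
  eq_of_polyOfBits_eq (by rw [length_pmodStr _ _ hf, length_pmodStr _ _ hf])
    (by rw [polyOfBits_pmodStr _ _ hf htop, polyOfBits_pmodStr _ _ hf htop, h])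

/-- **Horner's remainder as a fold** over the dividend from its top entry down. [folklore] -/
def pmodFold (m : ℕ) (f a : List Bool) : List Bool :=
  (List.range a.length).foldl (fun acc i => reduceTop m (a.getD (a.length - (i + 1)) false :: acc) f) (List.replicate m false)

/-- A `foldl` over `List.range n` only reads the function below `n`. [folklore] -/
theorem foldl_range_congr {α : Type*} {g g' : α → ℕ → α} (n : ℕ) (h : ∀ acc, ∀ i < n, g acc i = g' acc i) (acc : α) :
    (List.range n).foldl g acc = (List.range n).foldl g' acc := by
  induction n generalizing acc with
  | zero => rfl
  | succ n ih =>
    rw [List.range_succ, List.foldl_append, List.foldl_append, List.foldl_cons, List.foldl_nil, List.foldl_cons,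
      List.foldl_nil, ih (fun acc i hi => h acc i (by omega)), h _ n (by omega)]

/-- The fold is `pmodStr`. [folklore] -/
theorem pmodFold_eq (m : ℕ) (f : List Bool) : ∀ a, pmodFold m f a = pmodStr m f a
  | [] => rfl
  | x :: l => by
    rw [pmodFold, List.length_cons, List.range_succ, List.foldl_append, List.foldl_cons, List.foldl_nil, pmodStr,
      ← pmodFold_eq m f l, pmodFold]
    have h1 : (x :: l).getD (l.length + 1 - (l.length + 1)) false = x := by simp
    rw [h1]
    congr 2
    refine foldl_range_congr l.length (fun acc i hi => ?_) _
    have h2 : l.length + 1 - (i + 1) = (l.length - (i + 1)) + 1 := by omega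
    rw [h2, List.getD_cons_succ]

/-- The head of the length-`≤ 1` window at `m` is `getD m` (twin: `LYFP.headD_take_one_drop`,
`LundYannakakisProofs.lean`, outside this import closure). [folklore] -/
theorem headD_take_drop (l : List Bool) (m : ℕ) : ((l.drop m).take 1).headD false = l.getD m false := by
  rw [List.getD_eq_getElem?_getD]
  by_cases h : m < l.length
  · rw [List.take_one_drop_eq_of_lt_length h, List.getElem?_eq_getElem h]; rfl
  · push Not at h
    rw [List.drop_eq_nil_of_le h, List.take_nil, List.getElem?_eq_none_iff.2 h]; rfl

/-- The same, in `simp`-normal form. [folklore] -/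
@[simp] theorem getD_head?_take_drop (l : List Bool) (m : ℕ) : ((l.drop m).take 1).head?.getD false = l[m]?.getD false := by
  have := headD_take_drop l m
  rwa [List.headD_eq_head?_getD, List.getD_eq_getElem?_getD] at this

/-- The ruler `1ᵐ` cut from the modulus `f` (`m = |f| - 1`), on `⟨acc, ⟨piece, f⟩⟩`. [folklore] -/
def rulerF : List Bool → List Bool := dropFn ∘ fanoutFn (fun _ => [true]) (polyFn X ∘ sndF ∘ sndF)

/-- `rulerF ∈ FP`. [folklore] -/
theorem rulerF_mem_FP : rulerF ∈ FP :=
  comp_mem_FP dropFn_mem_FP (fanoutFn_mem_FP (const_mem_FP _) (comp_mem_FP (polyFn_mem_FP _) (comp_mem_FP sndF_mem_FP sndF_mem_FP)))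

/-- Value of the ruler. [folklore] -/
theorem rulerF_apply (acc p f : List Bool) : rulerF (boolPair acc (boolPair p f)) = ones (f.length - 1) := by
  simp [rulerF, ones, List.drop_replicate]

/-- The ruler is shorter than the second field. [folklore] -/
theorem length_rulerF_le (w : List Bool) : (rulerF w).length ≤ (sndF w).length := by
  simp only [rulerF, Function.comp_apply, fanoutFn_apply, dropFn_boolPair, polyFn_apply, eval_X, ones, List.length_drop,
    List.length_replicate]
  have := length_boolUnpair_parts_le (sndF w); simp only [sndF] at this ⊢; omega

/-- The extended accumulator `b :: acc` on `⟨acc, ⟨[b], f⟩⟩` (in general `piece ++ acc`). [folklore] -/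
def consF : List Bool → List Bool := appF ∘ fanoutFn (fstF ∘ sndF) fstF

/-- `consF ∈ FP`. [folklore] -/
theorem consF_mem_FP : consF ∈ FP :=
  comp_mem_FP appF_mem_FP (fanoutFn_mem_FP (comp_mem_FP fstF_mem_FP sndF_mem_FP) fstF_mem_FP)

/-- Value of `consF`. [folklore] -/
theorem consF_apply (acc p f : List Bool) : consF (boolPair acc (boolPair p f)) = p ++ acc := by simp [consF]

/-- **The reduction step** `redOpF ⟨acc, ⟨[b], f⟩⟩ = reduceTop m (b :: acc) f`, `m = |f| - 1`:
prepend the new low coefficient, clear the top coefficient by `f` if set (the condition bit is made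
total by `headBitFn`). [folklore] -/
def redOpF : List Bool → List Bool :=
  iteFn (HashBricks.headBitFn ∘ bitAtFn ∘ fanoutFn rulerF consF)
    (takeFn ∘ fanoutFn rulerF (xorF ∘ fanoutFn consF (sndF ∘ sndF)))
    (takeFn ∘ fanoutFn rulerF consF)

/-- `redOpF ∈ FP`. [folklore] -/
theorem redOpF_mem_FP : redOpF ∈ FP :=
  iteFn_mem_FP (comp_mem_FP HashBricks.headBitFn_mem_FP (comp_mem_FP bitAtFn_mem_FP (fanoutFn_mem_FP rulerF_mem_FP consF_mem_FP)))
    (comp_mem_FP takeFn_mem_FP (fanoutFn_mem_FP rulerF_mem_FP (comp_mem_FP xorF_mem_FP (fanoutFn_mem_FP consF_mem_FP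
      (comp_mem_FP sndF_mem_FP sndF_mem_FP)))))
    (comp_mem_FP takeFn_mem_FP (fanoutFn_mem_FP rulerF_mem_FP consF_mem_FP))

/-- Value of the reduction step (`|f| = m + 1`). [folklore] -/
theorem redOpF_apply {m : ℕ} (acc : List Bool) (b : Bool) (f : List Bool) (hf : f.length = m + 1) :
    redOpF (boolPair acc (boolPair [b] f)) = reduceTop m (b :: acc) f := by
  have hc : (HashBricks.headBitFn ∘ bitAtFn ∘ fanoutFn rulerF consF) (boolPair acc (boolPair [b] f)) =
      [(b :: acc).getD m false] := by
    simp only [Function.comp_apply, fanoutFn_apply, rulerF_apply, consF_apply, bitAtFn_boolPair, ones, List.length_replicate,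
      HashBricks.headBitFn_apply, hf, Nat.add_sub_cancel, List.singleton_append, headD_take_drop]
  rw [redOpF, iteFn_apply hc, reduceTop]
  split_ifs with h <;>
    simp [fanoutFn_apply, rulerF_apply, consF_apply, takeFn_boolPair, xorF_apply, ones, hf]

/-- Growth of the reduction step: at most `|sndF w|` symbols (a `take` under the ruler). [folklore] -/
theorem length_redOpF_le (w : List Bool) : (redOpF w).length ≤ (fstF w).length + (sndF w).length + 0 := by
  have hc : (HashBricks.headBitFn ∘ bitAtFn ∘ fanoutFn rulerF consF) w = [((bitAtFn (boolPair (rulerF w) (consF w)))).headD false] := by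
    simp
  rw [redOpF, iteFn_apply hc]
  have := length_rulerF_le w
  split_ifs <;> simp only [Function.comp_apply, fanoutFn_apply, takeFn_boolPair, List.length_take] <;> omega

/-- The dividend-entry piece on `⟨⟨a, f⟩, 1ⁱ⟩`: `⟨[a_{|a|-1-i}], f⟩` (top entry first). [folklore] -/
def pmPieceF : List Bool → List Bool :=
  fanoutFn (HashBricks.headBitFn ∘ bitAtFn ∘ fanoutFn
      (dropFn ∘ fanoutFn (appF ∘ fanoutFn sndF (fun _ => [true])) (polyFn X ∘ fstF ∘ fstF)) (fstF ∘ fstF))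
    (sndF ∘ fstF)

/-- `pmPieceF ∈ FP`. [folklore] -/
theorem pmPieceF_mem_FP : pmPieceF ∈ FP :=
  fanoutFn_mem_FP (comp_mem_FP HashBricks.headBitFn_mem_FP (comp_mem_FP bitAtFn_mem_FP (fanoutFn_mem_FP
      (comp_mem_FP dropFn_mem_FP (fanoutFn_mem_FP (comp_mem_FP appF_mem_FP (fanoutFn_mem_FP sndF_mem_FP (const_mem_FP _)))
        (comp_mem_FP (polyFn_mem_FP _) (comp_mem_FP fstF_mem_FP fstF_mem_FP)))) (comp_mem_FP fstF_mem_FP fstF_mem_FP))))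
    (comp_mem_FP sndF_mem_FP fstF_mem_FP)

/-- Value of the piece. [folklore] -/
theorem pmPieceF_apply (a f : List Bool) (i : ℕ) :
    pmPieceF (boolPair (boolPair a f) (ones i)) = boolPair [a.getD (a.length - (i + 1)) false] f := by
  simp only [pmPieceF, Function.comp_apply, fanoutFn_apply, sndF_boolPair, fstF_boolPair, appF_boolPair, polyFn_apply,
    eval_X, dropFn_boolPair, bitAtFn_boolPair, HashBricks.headBitFn_apply, headD_take_drop, ones, List.length_append,
    List.length_replicate, List.length_singleton, List.length_drop]

/-- The piece is short: `|⟨[b], f⟩| = |f| + 4`. [folklore] -/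
theorem length_pmPieceF (z : List Bool) : (pmPieceF z).length = (sndF (fstF z)).length + 4 := by
  simp only [pmPieceF, fanoutFn_apply, Function.comp_apply, HashBricks.headBitFn_apply, length_boolPair, List.length_singleton]
  omega

/-- **The remainder brick** `pmodF ⟨a, f⟩ = pmodStr (|f| - 1) f a`: Horner's rule from the top entry,
`|a|` rounds of `redOpF` from the zero accumulator. [folklore] -/
def pmodF : List Bool → List Bool :=
  sndPow 2 ∘ foldLoop redOpF (clipF 4 pmPieceF) X ∘
    fanoutFn (fun w => w) (fanoutFn (lenBinF ∘ fstF)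
      (fanoutFn (fun _ => []) (Kannan.zerosFn ∘ dropFn ∘ fanoutFn (fun _ => [true]) (polyFn X ∘ sndF))))

/-- `pmodF ∈ FP`. [folklore] -/
theorem pmodF_mem_FP : pmodF ∈ FP :=
  comp_mem_FP (sndPow_mem_FP 2) (comp_mem_FP
    (foldLoop_clipF_mem_FP 4 redOpF_mem_FP length_redOpF_le pmPieceF_mem_FP _)
    (fanoutFn_mem_FP (PolyTimeComputable.id _)
      (fanoutFn_mem_FP (comp_mem_FP lenBinF_mem_FP fstF_mem_FP)
        (fanoutFn_mem_FP (const_mem_FP _) (comp_mem_FP Kannan.zerosFn_mem_FP (comp_mem_FP dropFn_mem_FP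
          (fanoutFn_mem_FP (const_mem_FP _) (comp_mem_FP (polyFn_mem_FP _) sndF_mem_FP))))))))

/-- **Value of the remainder brick** (`|f| = m + 1`). [folklore] -/
theorem pmodF_apply {m : ℕ} (a f : List Bool) (hf : f.length = m + 1) : pmodF (boolPair a f) = pmodStr m f a := by
  have hk : a.length ≤ (X : Polynomial ℕ).eval (boolPair a f).length := by
    simp only [eval_X, length_boolPair]; omega
  have hz : Kannan.zerosFn (dropFn (boolPair [true] (polyFn X (sndF (boolPair a f))))) = List.replicate m false := by
    simp [hf, List.drop_replicate]
  have hloop := foldLoop_apply redOpF (clipF 4 pmPieceF) hk 0 (List.replicate m false)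
  rw [show ones 0 = ([] : List Bool) from rfl] at hloop
  simp only [pmodF, Function.comp_apply, fanoutFn_apply, lenBinF_apply, fstF_boolPair]
  rw [hz, hloop, sndPow_succ_boolPair, sndPow_succ_boolPair, sndPow_zero_boolPair, foldAcc_clipF (fun j _ hj => ?_)]
  · have hgen : ∀ (k i : ℕ) (acc : List Bool), foldAcc redOpF pmPieceF (boolPair a f) i k acc =
        (List.range' i k).foldl (fun acc j => reduceTop m (a.getD (a.length - (j + 1)) false :: acc) f) acc := by
      intro k
      induction k with
      | zero => intro i acc; simp
      | succ k ih =>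
        intro i acc
        rw [foldAcc_succ, List.range'_succ, List.foldl_cons, pmPieceF_apply, redOpF_apply _ _ _ hf, ih]
    rw [hgen, ← pmodFold_eq, pmodFold, List.range_eq_range']
  · rw [length_pmPieceF, fstF_boolPair, sndF_boolPair, length_boolPair]; omega

/-- The reduction step never exceeds the ruler: `|redOpF ⟨acc, ⟨p, f⟩⟩| ≤ |f| - 1`. [folklore] -/
theorem length_redOpF_le' (acc p f : List Bool) : (redOpF (boolPair acc (boolPair p f))).length ≤ f.length - 1 := by
  have hc : (HashBricks.headBitFn ∘ bitAtFn ∘ fanoutFn rulerF consF) (boolPair acc (boolPair p f)) =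
      [((bitAtFn (boolPair (rulerF (boolPair acc (boolPair p f))) (consF (boolPair acc (boolPair p f)))))).headD false] := by
    simp
  rw [redOpF, iteFn_apply hc]
  split_ifs <;> simp [fanoutFn_apply, rulerF_apply, takeFn_boolPair, ones]

/-- **The remainder brick returns at most `|f| - 1` symbols** (on any pair). [folklore] -/
theorem length_pmodF_le (a f : List Bool) : (pmodF (boolPair a f)).length ≤ f.length - 1 := by
  have hk : a.length ≤ (X : Polynomial ℕ).eval (boolPair a f).length := by
    simp only [eval_X, length_boolPair]; omega
  have hz : Kannan.zerosFn (dropFn (boolPair [true] (polyFn X (sndF (boolPair a f))))) = List.replicate (f.length - 1) false := by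
    simp [List.drop_replicate]
  have hloop := foldLoop_apply redOpF (clipF 4 pmPieceF) hk 0 (List.replicate (f.length - 1) false)
  rw [show ones 0 = ([] : List Bool) from rfl] at hloop
  simp only [pmodF, Function.comp_apply, fanoutFn_apply, lenBinF_apply, fstF_boolPair]
  rw [hz, hloop, sndPow_succ_boolPair, sndPow_succ_boolPair, sndPow_zero_boolPair, foldAcc_clipF (fun j _ hj => by
    rw [length_pmPieceF, fstF_boolPair, sndF_boolPair, length_boolPair]; omega)]
  have hgen : ∀ (k i : ℕ) (acc : List Bool), acc.length ≤ f.length - 1 →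
      (foldAcc redOpF pmPieceF (boolPair a f) i k acc).length ≤ f.length - 1 := by
    intro k
    induction k with
    | zero => intro i acc h; simpa using h
    | succ k ih =>
      intro i acc h
      rw [foldAcc_succ, pmPieceF_apply]
      exact ih _ _ (length_redOpF_le' _ _ _)
  exact hgen _ _ _ (by simp)

/-! ### B4. Field multiplication, squaring chains, inversion -/

/-- **The multiplication operation** `fmulOpF ⟨acc, ⟨b, f⟩⟩ = (acc · b) mod f` (shape of a fold operation). [folklore] -/
def fmulOpF : List Bool → List Bool := pmodF ∘ fanoutFn (clmulF ∘ fanoutFn fstF (fstF ∘ sndF)) (sndF ∘ sndF)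

/-- `fmulOpF ∈ FP`. [folklore] -/
theorem fmulOpF_mem_FP : fmulOpF ∈ FP :=
  comp_mem_FP pmodF_mem_FP (fanoutFn_mem_FP (comp_mem_FP clmulF_mem_FP (fanoutFn_mem_FP fstF_mem_FP
    (comp_mem_FP fstF_mem_FP sndF_mem_FP))) (comp_mem_FP sndF_mem_FP sndF_mem_FP))

/-- **Value of the multiplication operation on field elements** (modulus `modStr M`). [folklore] -/
theorem fmulOpF_bits (u v : GF2 M) :
    fmulOpF (boolPair (bits M u) (boolPair (bits M v) (modStr M))) = bits M (u * v) := by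
  rw [← fmulStr_bits, fmulStr]
  simp only [fmulOpF, Function.comp_apply, fanoutFn_apply, fstF_boolPair, sndF_boolPair, clmulF_apply]
  rw [pmodF_apply _ _ (modStr_top M).1]
  exact pmodStr_congr (modStr_top M).1 (modStr_top M).2 (by rw [polyOfBits_clmulFold, polyOfBits_clmul])

/-- Growth of the multiplication operation. [folklore] -/
theorem length_fmulOpF_le (w : List Bool) : (fmulOpF w).length ≤ (fstF w).length + (sndF w).length + 0 := by
  simp only [fmulOpF, Function.comp_apply, fanoutFn_apply]
  refine (length_pmodF_le _ _).trans ?_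
  have := length_boolUnpair_parts_le (sndF w); simp only [sndF] at this ⊢; omega

/-- **The squaring-chain operation** on a state `⟨acc, s⟩` with piece `⟨pad, f⟩`:
`⟨acc, s⟩ ↦ ⟨acc · s², s²⟩` (so after `r` rounds from `⟨1, u⟩`: `⟨u^{2^{r+1} - 2}, u^{2^r}⟩`). [folklore] -/
def invOpF : List Bool → List Bool :=
  fanoutFn (pmodF ∘ fanoutFn (clmulF ∘ fanoutFn (fstF ∘ fstF)
      (pmodF ∘ fanoutFn (clmulF ∘ fanoutFn (sndF ∘ fstF) (sndF ∘ fstF)) (sndF ∘ sndF))) (sndF ∘ sndF))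
    (pmodF ∘ fanoutFn (clmulF ∘ fanoutFn (sndF ∘ fstF) (sndF ∘ fstF)) (sndF ∘ sndF))

/-- `invOpF ∈ FP`. [folklore] -/
theorem invOpF_mem_FP : invOpF ∈ FP := by
  have hsq : (pmodF ∘ fanoutFn (clmulF ∘ fanoutFn (sndF ∘ fstF) (sndF ∘ fstF)) (sndF ∘ sndF)) ∈ FP :=
    comp_mem_FP pmodF_mem_FP (fanoutFn_mem_FP (comp_mem_FP clmulF_mem_FP (fanoutFn_mem_FP
      (comp_mem_FP sndF_mem_FP fstF_mem_FP) (comp_mem_FP sndF_mem_FP fstF_mem_FP))) (comp_mem_FP sndF_mem_FP sndF_mem_FP))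
  exact fanoutFn_mem_FP (comp_mem_FP pmodF_mem_FP (fanoutFn_mem_FP (comp_mem_FP clmulF_mem_FP (fanoutFn_mem_FP
    (comp_mem_FP fstF_mem_FP fstF_mem_FP) hsq)) (comp_mem_FP sndF_mem_FP sndF_mem_FP))) hsq

/-- **Value of the squaring-chain operation on field elements.** [folklore] -/
theorem invOpF_bits (acc s : GF2 M) (pad : List Bool) :
    invOpF (boolPair (boolPair (bits M acc) (bits M s)) (boolPair pad (modStr M))) =
      boolPair (bits M (acc * (s * s))) (bits M (s * s)) := by
  have hsq : (pmodF ∘ fanoutFn (clmulF ∘ fanoutFn (sndF ∘ fstF) (sndF ∘ fstF)) (sndF ∘ sndF))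
      (boolPair (boolPair (bits M acc) (bits M s)) (boolPair pad (modStr M))) = bits M (s * s) := by
    have := fmulOpF_bits M s s
    simp only [fmulOpF, Function.comp_apply, fanoutFn_apply, fstF_boolPair, sndF_boolPair] at this ⊢
    exact this
  have hmul := fmulOpF_bits M acc (s * s)
  simp only [fmulOpF, Function.comp_apply, fanoutFn_apply, fstF_boolPair, sndF_boolPair] at hmul hsq ⊢
  rw [invOpF, fanoutFn_apply]
  simp only [Function.comp_apply, fanoutFn_apply, fstF_boolPair, sndF_boolPair, hsq, hmul]

/-- Growth of the squaring-chain operation (the piece carries a pad `1^{2|f|}`). [folklore] -/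
theorem length_invOpF_le (w : List Bool) (hpad : 2 * (sndF (sndF w)).length ≤ (fstF (sndF w)).length) :
    (invOpF w).length ≤ (fstF w).length + (sndF w).length + 2 := by
  rw [invOpF, fanoutFn_apply, length_boolPair]
  simp only [Function.comp_apply, fanoutFn_apply]
  have h1 := length_pmodF_le (clmulF (boolPair (fstF (fstF w)) (pmodF (boolPair (clmulF (boolPair (sndF (fstF w))
    (sndF (fstF w)))) (sndF (sndF w)))))) (sndF (sndF w))
  have h2 := length_pmodF_le (clmulF (boolPair (sndF (fstF w)) (sndF (fstF w)))) (sndF (sndF w))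
  have h3 := length_boolUnpair_parts_le (sndF w)
  have h4 : (boolPair (fstF (sndF w)) (sndF (sndF w))).length ≤ (sndF w).length ∨ True := Or.inr trivial
  simp only [fstF, sndF] at h1 h2 h3 hpad ⊢
  omega

/-- **Clipping an operation to additive growth**: `clipOp op w = (op w) ↾ (|fstF w| + |sndF w|)` — the
growth law `foldLoop_mem_FP` asks of operations, enforced on every input and invisible on the
intended ones (`clipOp_eq`). [folklore] -/
def clipOp (op : List Bool → List Bool) : List Bool → List Bool := takeFn ∘ fanoutFn appF op

/-- `clipOp op ∈ FP`. [folklore] -/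
theorem clipOp_mem_FP {op : List Bool → List Bool} (hop : op ∈ FP) : clipOp op ∈ FP :=
  comp_mem_FP takeFn_mem_FP (fanoutFn_mem_FP appF_mem_FP hop)

/-- Growth of a clipped operation. [folklore] -/
theorem length_clipOp_le (op : List Bool → List Bool) (w : List Bool) :
    (clipOp op w).length ≤ (fstF w).length + (sndF w).length + 0 := by
  simp only [clipOp, Function.comp_apply, fanoutFn_apply, takeFn_boolPair, List.length_take, appF, List.length_append]
  omega

/-- Unclipping. [folklore] -/
theorem clipOp_eq {op : List Bool → List Bool} {w : List Bool} (h : (op w).length ≤ (fstF w).length + (sndF w).length) :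
    clipOp op w = op w := by
  simp only [clipOp, Function.comp_apply, fanoutFn_apply, takeFn_boolPair, appF, List.length_append]
  exact List.take_of_length_le h

/-- The bits of `1`. [folklore] -/
theorem bits_one : bits M 1 = true :: List.replicate M false := by
  rw [bits]
  apply List.ext_getElem (by simp)
  intro i h1 h2
  rw [List.getElem_ofFn, SelfCorrect.encF_one]
  cases i with
  | zero => simp
  | succ i => simp

/-- The inversion piece on `⟨⟨a, f⟩, 1ʲ⟩`: `⟨[], f⟩`. [folklore] -/
def invPieceF : List Bool → List Bool := fanoutFn (fun _ => []) (sndF ∘ fstF)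

/-- `invPieceF ∈ FP`. [folklore] -/
theorem invPieceF_mem_FP : invPieceF ∈ FP := fanoutFn_mem_FP (const_mem_FP _) (comp_mem_FP sndF_mem_FP fstF_mem_FP)

/-- The initial state `⟨1, a⟩` on `⟨a, f⟩` (`1 = 1 0^M`, `M = |f| - 2`). [folklore] -/
def invInitF : List Bool → List Bool :=
  fanoutFn (appF ∘ fanoutFn (fun _ => [true]) (Kannan.zerosFn ∘ dropFn ∘ fanoutFn (fun _ => [true, true]) sndF)) fstF

/-- `invInitF ∈ FP`. [folklore] -/
theorem invInitF_mem_FP : invInitF ∈ FP :=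
  fanoutFn_mem_FP (comp_mem_FP appF_mem_FP (fanoutFn_mem_FP (const_mem_FP _) (comp_mem_FP Kannan.zerosFn_mem_FP
    (comp_mem_FP dropFn_mem_FP (fanoutFn_mem_FP (const_mem_FP _) sndF_mem_FP))))) fstF_mem_FP

/-- **The inversion brick** `finvF ⟨a, f⟩`: `M = |f| - 2` rounds of the squaring chain from `⟨1, a⟩`,
then the accumulator `a^{2^{M+1} - 2} = a⁻¹`. [folklore] -/
def finvF : List Bool → List Bool :=
  fstF ∘ sndPow 2 ∘ foldLoop (clipOp invOpF) (clipF 1 invPieceF) X ∘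
    fanoutFn (fun w => w) (fanoutFn (lenBinF ∘ dropFn ∘ fanoutFn (fun _ => [true, true]) sndF)
      (fanoutFn (fun _ => []) invInitF))

/-- `finvF ∈ FP`. [folklore] -/
theorem finvF_mem_FP : finvF ∈ FP :=
  comp_mem_FP fstF_mem_FP (comp_mem_FP (sndPow_mem_FP 2) (comp_mem_FP
    (foldLoop_clipF_mem_FP 1 (clipOp_mem_FP invOpF_mem_FP) (length_clipOp_le invOpF) invPieceF_mem_FP _)
    (fanoutFn_mem_FP (PolyTimeComputable.id _)
      (fanoutFn_mem_FP (comp_mem_FP lenBinF_mem_FP (comp_mem_FP dropFn_mem_FP (fanoutFn_mem_FP (const_mem_FP _) sndF_mem_FP)))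
        (fanoutFn_mem_FP (const_mem_FP _) invInitF_mem_FP)))))

/-- **Value of the inversion brick on a field element**: `u^{2^{M+1} - 2}`. [folklore] -/
theorem finvF_bits (u : GF2 M) : finvF (boolPair (bits M u) (modStr M)) = bits M (u ^ (2 ^ (M + 1) - 2)) := by
  have hf := (modStr_top M).1
  have hk : M ≤ (X : Polynomial ℕ).eval (boolPair (bits M u) (modStr M)).length := by
    simp only [eval_X, length_boolPair, length_bits]; omega
  have hinit : invInitF (boolPair (bits M u) (modStr M)) = boolPair (bits M 1) (bits M u) := by
    simp [invInitF, bits_one, hf]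
  have hcnt : lenBinF (dropFn (boolPair [true, true] (sndF (boolPair (bits M u) (modStr M))))) = encodeNat M := by
    simp [hf]
  have hloop := foldLoop_apply (clipOp invOpF) (clipF 1 invPieceF) hk 0 (boolPair (bits M 1) (bits M u))
  rw [show ones 0 = ([] : List Bool) from rfl] at hloop
  simp only [finvF, Function.comp_apply, fanoutFn_apply]
  rw [hcnt, hinit, hloop, sndPow_succ_boolPair, sndPow_succ_boolPair, sndPow_zero_boolPair,
    foldAcc_clipF (fun j _ _ => by simp [invPieceF, length_boolPair]; omega)]
  -- the invariant of the squaring chain: state `⟨u^{2^{t+1}-2}, u^{2^t}⟩`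
  have hsq : ∀ t : ℕ, u ^ 2 ^ t * u ^ 2 ^ t = u ^ 2 ^ (t + 1) := fun t => by
    rw [← pow_add, ← two_mul, ← pow_succ']
  have hacc : ∀ t : ℕ, u ^ (2 ^ (t + 1) - 2) * u ^ 2 ^ (t + 1) = u ^ (2 ^ (t + 1 + 1) - 2) := fun t => by
    have h2 : 2 ≤ 2 ^ (t + 1) :=
      calc (2:ℕ) = 2 ^ 1 := by norm_num
        _ ≤ 2 ^ (t + 1) := Nat.pow_le_pow_right (by norm_num) (by omega)
    have h3 : 2 ^ (t + 1 + 1) = 2 ^ (t + 1) + 2 ^ (t + 1) := by rw [pow_succ]; ring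
    have h4 : 2 ^ (t + 1) - 2 + 2 ^ (t + 1) = 2 ^ (t + 1 + 1) - 2 := by omega
    rw [← pow_add, h4]
  have hgen : ∀ r i t : ℕ, foldAcc (clipOp invOpF) invPieceF (boolPair (bits M u) (modStr M)) i r
      (boolPair (bits M (u ^ (2 ^ (t + 1) - 2))) (bits M (u ^ 2 ^ t))) =
      boolPair (bits M (u ^ (2 ^ (t + r + 1) - 2))) (bits M (u ^ 2 ^ (t + r))) := by
    intro r
    induction r with
    | zero => intro i t; simp only [foldAcc_zero, add_zero]
    | succ r ih =>
      intro i t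
      rw [foldAcc_succ]
      have hp : invPieceF (boolPair (boolPair (bits M u) (modStr M)) (ones i)) = boolPair [] (modStr M) := by
        simp [invPieceF]
      rw [hp, clipOp_eq (by
        rw [invOpF_bits, fstF_boolPair, sndF_boolPair, length_boolPair, length_boolPair, length_boolPair, length_bits,
          length_bits, length_bits, length_bits]; omega), invOpF_bits, hsq, hacc, show t + (r + 1) = (t + 1) + r by omega]
      exact ih (i + 1) (t + 1)
  have := hgen M 0 0
  norm_num at this
  rw [this, fstF_boolPair]

/-! ### B5. The modulus search: trial division over all small bitmasks -/

/-- The canonical numeral of `q ≥ 1` is its `⌊log₂ q⌋ + 1` bits. [folklore] -/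
theorem encodeNat_eq_natBits {q : ℕ} (hq : 1 ≤ q) : encodeNat q = natBits (Nat.log 2 q + 1) q := by
  have h1 : (encodeNat q).length = Nat.log 2 q + 1 := by
    apply le_antisymm
    · -- `q < 2^{log q + 1}`
      have := PRGDerand.takeD_encodeNat_eq_natBits (Nat.lt_pow_succ_log_self one_lt_two q)
      have hlen := congrArg List.length this
      rw [length_natBits] at hlen
      by_contra h
      push Not at h
      -- a canonical numeral longer than `log q + 1` bits would be `≥ 2^{log q + 1}`
      rcases encodeNat_canonical q with h0 | ⟨v, hv⟩
      · rw [h0] at h; simp at h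
      · have hval := bitsToNat_encodeNat q
        rw [hv] at hval h
        rw [List.length_append, List.length_singleton] at h
        have := bitsToNat_append_true v
        rw [hval] at this
        have h2 : 2 ^ (Nat.log 2 q + 1) ≤ 2 ^ v.length := Nat.pow_le_pow_right (by norm_num) (by omega)
        have h3 := Nat.lt_pow_succ_log_self one_lt_two q
        omega
    · by_contra h
      push Not at h
      have := bitsToNat_lt (encodeNat q)
      rw [bitsToNat_encodeNat] at this
      have h2 : 2 ^ (encodeNat q).length ≤ 2 ^ Nat.log 2 q := Nat.pow_le_pow_right (by norm_num) (by omega)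
      have h3 := Nat.pow_log_le_self 2 (by omega : q ≠ 0)
      omega
  conv_lhs => rw [CoinEnum.eq_natBits_of_length h1, bitsToNat_encodeNat]

/-- A numeral is all zeros iff its value is `0`. [folklore] -/
theorem eq_replicate_iff_bitsToNat_eq_zero (l : List Bool) : l = List.replicate l.length false ↔ bitsToNat l = 0 := by
  constructor
  · intro h; rw [h]; exact bitsToNat_replicate_false _
  · intro h
    have := CoinEnum.eq_natBits_of_length (rfl : l.length = l.length)
    rw [h, CoinEnum.natBits_zero] at this
    exact this

/-- **The one-bit AND operation** on the heads of accumulator and piece (total). [folklore] -/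
def andOpF : List Bool → List Bool := andFn (HashBricks.headBitFn ∘ fstF) (HashBricks.headBitFn ∘ sndF)

/-- `andOpF ∈ FP`. [folklore] -/
theorem andOpF_mem_FP : andOpF ∈ FP :=
  andFn_mem_FP (comp_mem_FP HashBricks.headBitFn_mem_FP fstF_mem_FP) (comp_mem_FP HashBricks.headBitFn_mem_FP sndF_mem_FP)

/-- Value of `andOpF`. [folklore] -/
theorem andOpF_apply (w : List Bool) : andOpF w = [(fstF w).headD false && (sndF w).headD false] :=
  andFn_apply (by simp) (by simp)

/-- Growth of `andOpF`. [folklore] -/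
theorem length_andOpF_le (w : List Bool) : (andOpF w).length ≤ (fstF w).length + (sndF w).length + 1 := by
  rw [andOpF_apply]; simp

/-- **The non-divisibility piece** on `⟨⟨ν, fuel⟩, 1^q⟩` (`ν` the bits of the candidate `n`):
`[¬ bitsPoly q ∣ bitsPoly n]`, by reducing `ν` modulo the numeral of `q` and testing for zero. [folklore] -/
def ndvdPieceF : List Bool → List Bool :=
  notFn (isNilFn ∘ norm ∘ pmodF ∘ fanoutFn (fstF ∘ fstF) (lenBinF ∘ sndF))

/-- `ndvdPieceF ∈ FP`. [folklore] -/
theorem ndvdPieceF_mem_FP : ndvdPieceF ∈ FP :=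
  notFn_mem_FP (comp_mem_FP isNilFn_mem_FP (comp_mem_FP norm_mem_FP (comp_mem_FP pmodF_mem_FP
    (fanoutFn_mem_FP (comp_mem_FP fstF_mem_FP fstF_mem_FP) (comp_mem_FP lenBinF_mem_FP sndF_mem_FP)))))

/-- Value of the non-divisibility piece (`q ≥ 1`, `ν = natBits (⌊log₂ n⌋ + 1) n`). [folklore] -/
theorem ndvdPieceF_apply (n : ℕ) (fuel : List Bool) {q : ℕ} (hq : 1 ≤ q) :
    ndvdPieceF (boolPair (boolPair (natBits (Nat.log 2 n + 1) n) fuel) (ones q)) = [!dvdTestB q n] := by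
  have hlen : (encodeNat q).length = Nat.log 2 q + 1 := by rw [encodeNat_eq_natBits hq, length_natBits]
  unfold ndvdPieceF
  refine notFn_apply ?_
  simp only [Function.comp_apply, fanoutFn_apply, fstF_boolPair, sndF_boolPair, lenBinF_apply, ones, List.length_replicate]
  rw [pmodF_apply _ _ hlen, isNilFn, dvdTestB, ← encodeNat_eq_natBits hq]
  congr 1
  apply Bool.decide_congr
  rw [norm_eq_nil_iff, ← eq_replicate_iff_bitsToNat_eq_zero, length_pmodStr _ _ hlen]

/-- The one-bit piece is short. [folklore] -/
theorem length_ndvdPieceF_le (z : List Bool) : (ndvdPieceF z).length ≤ 1 := by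
  unfold ndvdPieceF
  rw [notFn_apply (b := decide (norm (pmodF (fanoutFn (fstF ∘ fstF) (lenBinF ∘ sndF) z)) = [])) (by simp [isNilFn])]
  simp

/-- The counter `encodeNat (2^{M+1} - 2)` of the trial-division loop, from `ν` of `M + 2` bits. [folklore] -/
def trialCntF : List Bool → List Bool :=
  subFn ∘ fanoutFn ((fun w => Kannan.zerosFn w ++ [true]) ∘ dropFn ∘ fanoutFn (fun _ => [true]) (polyFn X ∘ fstF))
    fun _ => encodeNat 2

/-- `trialCntF ∈ FP`. [folklore] -/
theorem trialCntF_mem_FP : trialCntF ∈ FP :=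
  comp_mem_FP subFn_mem_FP (fanoutFn_mem_FP (comp_mem_FP (append_mem_FP Kannan.zerosFn_mem_FP (const_mem_FP _))
    (comp_mem_FP dropFn_mem_FP (fanoutFn_mem_FP (const_mem_FP _) (comp_mem_FP (polyFn_mem_FP _) fstF_mem_FP)))) (const_mem_FP _))

/-- `bitsToNat (0ᵏ 1) = 2ᵏ` (twins: `TodaPartTwo.bitsToNat_zeros_one`, `LadnerResolve`'s private copy; neither importable
here without their developments). [folklore] -/
theorem bitsToNat_zeros_append_true (k : ℕ) : bitsToNat (List.replicate k false ++ [true]) = 2 ^ k := by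
  rw [bitsToNat_append_true, bitsToNat_replicate_false, List.length_replicate, zero_add]

/-- Value of the counter. [folklore] -/
theorem trialCntF_apply (ν fuel : List Bool) : trialCntF (boolPair ν fuel) = encodeNat (2 ^ (ν.length - 1) - 2) := by
  simp [trialCntF, bitsToNat_zeros_append_true, List.drop_replicate]

/-- **The trial-division test** `irredF ⟨ν, fuel⟩ = [irredFull M n]` for `ν = natBits (M+2) n` the bits
of a candidate `n ∈ [2^{M+1}, 2^{M+2})` and `|fuel| ≥ 2^{M+1}`: the AND-fold of the non-divisibility
pieces over `q = 2, …, 2^{M+1} - 1`. [folklore] -/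
def irredF : List Bool → List Bool :=
  sndPow 2 ∘ foldLoop andOpF (clipF 1 ndvdPieceF) X ∘
    fanoutFn (fun w => w) (fanoutFn trialCntF (fanoutFn (fun _ => ones 2) fun _ => [true]))

/-- `irredF ∈ FP`. [folklore] -/
theorem irredF_mem_FP : irredF ∈ FP :=
  comp_mem_FP (sndPow_mem_FP 2) (comp_mem_FP
    (foldLoop_clipF_mem_FP 1 andOpF_mem_FP length_andOpF_le ndvdPieceF_mem_FP _)
    (fanoutFn_mem_FP (PolyTimeComputable.id _)
      (fanoutFn_mem_FP trialCntF_mem_FP (fanoutFn_mem_FP (const_mem_FP _) (const_mem_FP _)))))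

/-- The AND-fold of one-bit pieces. [folklore] -/
theorem foldl_and_bits (g : ℕ → Bool) : ∀ (k i : ℕ) (b : Bool),
    (List.range' i k).foldl (fun acc j => [acc.headD false && [g j].headD false]) [b] =
      [b && (List.range' i k).all g]
  | 0, i, b => by simp
  | k + 1, i, b => by
    rw [List.range'_succ, List.foldl_cons, List.headD_cons, List.headD_cons, foldl_and_bits g k (i + 1), List.all_cons,
      Bool.and_assoc]

/-- **Value of the trial-division test.** [folklore] -/
theorem irredF_apply {n : ℕ} (fuel : List Bool) (h1 : 2 ^ (M + 1) ≤ n) (h2 : n < 2 ^ (M + 2))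
    (hfuel : 2 ^ (M + 1) ≤ fuel.length) :
    irredF (boolPair (natBits (M + 2) n) fuel) = [irredFull M n] := by
  have hlogn : Nat.log 2 n = M + 1 := Nat.log_eq_of_pow_le_of_lt_pow h1 h2
  have hk : 2 ^ (M + 1) - 2 ≤ (X : Polynomial ℕ).eval (boolPair (natBits (M + 2) n) fuel).length := by
    simp only [eval_X, length_boolPair]; omega
  have hloop := foldLoop_apply andOpF (clipF 1 ndvdPieceF) hk 2 [true]
  simp only [irredF, Function.comp_apply, fanoutFn_apply, trialCntF_apply, length_natBits]
  rw [show M + 2 - 1 = M + 1 by omega, hloop, sndPow_succ_boolPair, sndPow_succ_boolPair, sndPow_zero_boolPair,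
    foldAcc_clipF (fun j _ _ => (length_ndvdPieceF_le _).trans (by omega))]
  have hν : natBits (M + 2) n = natBits (Nat.log 2 n + 1) n := by rw [hlogn]
  rw [foldAcc_eq_foldl andOpF ndvdPieceF _ (fun a b => [a.headD false && b.headD false]) (fun q => [!dvdTestB q n]) _ _ _
    (fun a j _ _ => by rw [andOpF_apply, fstF_boolPair, sndF_boolPair]) (fun j hj _ => ?_)]
  · rw [foldl_and_bits, Bool.true_and, irredFull]
    congr 1
    rw [Bool.eq_iff_iff, List.all_eq_true, decide_eq_true_iff]
    simp only [List.mem_range'_1, Bool.not_eq_true', and_imp]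
    constructor
    · intro h q hq hqlt; exact h q hq (by omega)
    · intro h q hq hqlt; exact h q hq (by omega)
  · rw [hν]; exact ndvdPieceF_apply n fuel (by omega)

/-- **The candidate numeral** on `⟨⟨1^{M+1}, fuel⟩, 1ⁱ⟩`: `natBits (M+2) (2^{M+1} + i) = natBits (M+1) i ++ [1]`. [folklore] -/
def scandF : List Bool → List Bool :=
  appF ∘ fanoutFn (fstF ∘ padTakeFn ∘ fanoutFn (fstF ∘ fstF) (lenBinF ∘ sndF)) fun _ => [true]

/-- `scandF ∈ FP`. [folklore] -/
theorem scandF_mem_FP : scandF ∈ FP :=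
  comp_mem_FP appF_mem_FP (fanoutFn_mem_FP (comp_mem_FP fstF_mem_FP (comp_mem_FP padTakeFn_mem_FP
    (fanoutFn_mem_FP (comp_mem_FP fstF_mem_FP fstF_mem_FP) (comp_mem_FP lenBinF_mem_FP sndF_mem_FP)))) (const_mem_FP _))

/-- The bits of `2^{M+1} + i` (`i < 2^{M+1}`). [folklore] -/
theorem natBits_two_pow_add (M i : ℕ) (hi : i < 2 ^ (M + 1)) :
    natBits (M + 2) (2 ^ (M + 1) + i) = natBits (M + 1) i ++ [true] := by
  rw [show M + 2 = (M + 1) + 1 by ring, NWMachine.natBits_add, ← NWMachine.natBits_mod]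
  congr 1
  · congr 1; rw [Nat.add_mod, Nat.mod_self, zero_add, Nat.mod_mod, Nat.mod_eq_of_lt hi]
  · rw [Nat.add_div (Nat.two_pow_pos _), Nat.div_self (Nat.two_pow_pos _), Nat.div_eq_of_lt hi]
    simp [natBits, Nat.mod_self, show ¬ (2 ^ (M + 1) ≤ i % 2 ^ (M + 1)) from not_le.2 (Nat.mod_lt _ (Nat.two_pow_pos _))]

/-- Value of the candidate numeral. [folklore] -/
theorem scandF_apply (M i : ℕ) (fuel : List Bool) (hi : i < 2 ^ (M + 1)) :
    scandF (boolPair (boolPair (ones (M + 1)) fuel) (ones i)) = natBits (M + 2) (2 ^ (M + 1) + i) := by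
  rw [natBits_two_pow_add M i hi, ← PRGDerand.takeD_encodeNat_eq_natBits hi]
  simp only [scandF, Function.comp_apply, fanoutFn_apply, fstF_boolPair, sndF_boolPair, lenBinF_apply, ones,
    List.length_replicate, padTakeFn_boolPair, appF_boolPair]

/-- **The search piece**: the candidate numeral if it passes the test, else `[]`. [folklore] -/
def searchPieceF : List Bool → List Bool := iteFn (irredF ∘ fanoutFn scandF (sndF ∘ fstF)) scandF fun _ => []

/-- `searchPieceF ∈ FP`. [folklore] -/
theorem searchPieceF_mem_FP : searchPieceF ∈ FP :=
  iteFn_mem_FP (comp_mem_FP irredF_mem_FP (fanoutFn_mem_FP scandF_mem_FP (comp_mem_FP sndF_mem_FP fstF_mem_FP)))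
    scandF_mem_FP (const_mem_FP _)

/-- Value of the search piece (`|fuel| ≥ 2^{M+1}`). [folklore] -/
theorem searchPieceF_apply (M i : ℕ) (fuel : List Bool) (hi : i < 2 ^ (M + 1)) (hfuel : 2 ^ (M + 1) ≤ fuel.length) :
    searchPieceF (boolPair (boolPair (ones (M + 1)) fuel) (ones i)) =
      if irredFull M (2 ^ (M + 1) + i) then natBits (M + 2) (2 ^ (M + 1) + i) else [] := by
  have hc : (irredF ∘ fanoutFn scandF (sndF ∘ fstF)) (boolPair (boolPair (ones (M + 1)) fuel) (ones i)) =
      [irredFull M (2 ^ (M + 1) + i)] := by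
    simp only [Function.comp_apply, fanoutFn_apply, scandF_apply M i fuel hi, sndF_boolPair, fstF_boolPair]
    exact irredF_apply M fuel (by omega) (by rw [pow_succ (n := M + 1)]; omega) hfuel
  rw [searchPieceF, iteFn_apply hc]
  split_ifs <;> simp [scandF_apply M i fuel hi]

/-- **The keep-first operation** `searchOpF ⟨acc, piece⟩ = if acc = [] then piece else acc`. [folklore] -/
def searchOpF : List Bool → List Bool := iteFn (isNilFn ∘ fstF) sndF fstF

/-- `searchOpF ∈ FP`. [folklore] -/
theorem searchOpF_mem_FP : searchOpF ∈ FP := iteFn_mem_FP (comp_mem_FP isNilFn_mem_FP fstF_mem_FP) sndF_mem_FP fstF_mem_FP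

/-- Value of the keep-first operation. [folklore] -/
theorem searchOpF_apply (w : List Bool) : searchOpF w = if fstF w = [] then sndF w else fstF w := by
  rw [searchOpF, iteFn_apply (b := decide (fstF w = [])) (by simp [isNilFn])]
  by_cases h : fstF w = [] <;> simp [h]

/-- Growth of the keep-first operation. [folklore] -/
theorem length_searchOpF_le (w : List Bool) : (searchOpF w).length ≤ (fstF w).length + (sndF w).length + 0 := by
  rw [searchOpF_apply]; split_ifs <;> omega

/-- **The modulus-search brick** `modSearchF ⟨1^{M+1}, fuel⟩ = modStr M` (`|fuel| ≥ 2^{M+1}`): the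
keep-first fold of the search pieces over the `2^{M+1}` candidates. [folklore] -/
def modSearchF : List Bool → List Bool :=
  sndPow 2 ∘ foldLoop searchOpF (clipF 1 searchPieceF) X ∘
    fanoutFn (fun w => w) (fanoutFn ((fun w => Kannan.zerosFn w ++ [true]) ∘ fstF) fun _ => boolPair [] [])

/-- `modSearchF ∈ FP`. [folklore] -/
theorem modSearchF_mem_FP : modSearchF ∈ FP :=
  comp_mem_FP (sndPow_mem_FP 2) (comp_mem_FP
    (foldLoop_clipF_mem_FP 1 searchOpF_mem_FP length_searchOpF_le searchPieceF_mem_FP _)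
    (fanoutFn_mem_FP (PolyTimeComputable.id _)
      (fanoutFn_mem_FP (comp_mem_FP (append_mem_FP Kannan.zerosFn_mem_FP (const_mem_FP _)) fstF_mem_FP) (const_mem_FP _))))

/-- `0ᵏ 1` is the canonical numeral of `2ᵏ`. [folklore] -/
theorem zeros_append_true_eq_encodeNat (k : ℕ) : List.replicate k false ++ [true] = encodeNat (2 ^ k) := by
  refine eq_of_bitsToNat_eq_of_canonical _ _ (Or.inr ⟨_, rfl⟩) (encodeNat_canonical _) ?_
  rw [bitsToNat_zeros_append_true, bitsToNat_encodeNat]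

/-- **Value of the modulus-search brick.** [folklore] -/
theorem modSearchF_apply (fuel : List Bool) (hfuel : 2 ^ (M + 1) ≤ fuel.length) :
    modSearchF (boolPair (ones (M + 1)) fuel) = modStr M := by
  have hk : 2 ^ (M + 1) ≤ (X : Polynomial ℕ).eval (boolPair (ones (M + 1)) fuel).length := by
    simp only [eval_X, length_boolPair]; omega
  have hloop := foldLoop_apply searchOpF (clipF 1 searchPieceF) hk 0 []
  rw [show ones 0 = ([] : List Bool) from rfl] at hloop
  simp only [modSearchF, Function.comp_apply, fanoutFn_apply, fstF_boolPair, Kannan.zerosFn_apply, ones, List.length_replicate,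
    zeros_append_true_eq_encodeNat]
  simp only [ones] at hloop
  rw [hloop, sndPow_succ_boolPair, sndPow_succ_boolPair, sndPow_zero_boolPair,
    foldAcc_clipF (fun j _ hj => ?_)]
  · rw [foldAcc_eq_foldl searchOpF searchPieceF _ (fun a b => if a = [] then b else a)
      (fun i => if irredFull M (2 ^ (M + 1) + i) then natBits (M + 2) (2 ^ (M + 1) + i) else []) _ _ _
      (fun a j _ _ => by rw [searchOpF_apply, fstF_boolPair, sndF_boolPair]) (fun j _ hj => ?_)]
    · rw [← modSearch_eq, modSearch, List.range_eq_range']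
    · exact searchPieceF_apply M j fuel (by omega) hfuel
  · have := searchPieceF_apply M j fuel (by omega) hfuel
    simp only [ones] at this
    rw [this]
    split_ifs <;> simp [length_boolPair]; omega

/-- Value of the multiplication operation with the true modulus, on ANY operand strings. [folklore] -/
theorem fmulOpF_apply_mod (acc b : List Bool) : fmulOpF (boolPair acc (boolPair b (modStr M))) = fmulStr M acc b := by
  simp only [fmulOpF, Function.comp_apply, fanoutFn_apply, fstF_boolPair, sndF_boolPair, clmulF_apply]
  rw [pmodF_apply _ _ (modStr_top M).1, fmulStr]
  exact pmodStr_congr (modStr_top M).1 (modStr_top M).2 (by rw [polyOfBits_clmulFold, polyOfBits_clmul])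

/-- `finvF` agrees with the value-level inverse on field elements. [folklore] -/
theorem finvF_eq_finvStr (u : GF2 M) : finvF (boolPair (bits M u) (modStr M)) = finvStr M (bits M u) := by
  rw [finvF_bits, finvStr, fpowStr_bits]

/-! ### B6. The Lagrange indicator `δ_c(t)` -/

section Delta

/-- Accessors of the indicator context `z = ⟨⟨⟨c, t⟩, ⟨f, ⟨1^η, R⟩⟩⟩, 1^{c'}⟩`. [folklore] -/
def dC : List Bool → List Bool := fstF ∘ fstF ∘ fstF
/-- The evaluation point `t`. [folklore] -/
def dT : List Bool → List Bool := sndF ∘ fstF ∘ fstF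
/-- The modulus `f`. [folklore] -/
def dF : List Bool → List Bool := fstF ∘ sndF ∘ fstF
/-- The ruler `1^η`. [folklore] -/
def dEta : List Bool → List Bool := fstF ∘ sndF ∘ sndF ∘ fstF

/-- The accessors are in `FP`. [folklore] -/
theorem dAcc_mem_FP : dC ∈ FP ∧ dT ∈ FP ∧ dF ∈ FP ∧ dEta ∈ FP :=
  ⟨comp_mem_FP fstF_mem_FP (comp_mem_FP fstF_mem_FP fstF_mem_FP),
   comp_mem_FP sndF_mem_FP (comp_mem_FP fstF_mem_FP fstF_mem_FP),
   comp_mem_FP fstF_mem_FP (comp_mem_FP sndF_mem_FP fstF_mem_FP),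
   comp_mem_FP fstF_mem_FP (comp_mem_FP sndF_mem_FP (comp_mem_FP sndF_mem_FP fstF_mem_FP))⟩

/-- The zero padding `0^{M+1-η}` (cut from `f` past `η + 1` symbols). [folklore] -/
def dPad : List Bool → List Bool := Kannan.zerosFn ∘ dropFn ∘ fanoutFn (appF ∘ fanoutFn dEta fun _ => [true]) dF

/-- `dPad ∈ FP`. [folklore] -/
theorem dPad_mem_FP : dPad ∈ FP :=
  comp_mem_FP Kannan.zerosFn_mem_FP (comp_mem_FP dropFn_mem_FP (fanoutFn_mem_FP
    (comp_mem_FP appF_mem_FP (fanoutFn_mem_FP dAcc_mem_FP.2.2.2 (const_mem_FP _))) dAcc_mem_FP.2.2.1))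

/-- The other cube point `cubeStrN c'` (from the round index). [folklore] -/
def dCube' : List Bool → List Bool := appF ∘ fanoutFn (fstF ∘ padTakeFn ∘ fanoutFn dEta (lenBinF ∘ sndF)) dPad

/-- `dCube' ∈ FP`. [folklore] -/
theorem dCube'_mem_FP : dCube' ∈ FP :=
  comp_mem_FP appF_mem_FP (fanoutFn_mem_FP (comp_mem_FP fstF_mem_FP (comp_mem_FP padTakeFn_mem_FP
    (fanoutFn_mem_FP dAcc_mem_FP.2.2.2 (comp_mem_FP lenBinF_mem_FP sndF_mem_FP)))) dPad_mem_FP)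

/-- This cube point `cubeStrN c`. [folklore] -/
def dCube : List Bool → List Bool := appF ∘ fanoutFn dC dPad

/-- `dCube ∈ FP`. [folklore] -/
theorem dCube_mem_FP : dCube ∈ FP := comp_mem_FP appF_mem_FP (fanoutFn_mem_FP dAcc_mem_FP.1 dPad_mem_FP)

/-- The factor `(v_c - v_{c'})⁻¹ (t - v_{c'})`. [folklore] -/
def dFactor : List Bool → List Bool :=
  fmulOpF ∘ fanoutFn (finvF ∘ fanoutFn (xorF ∘ fanoutFn dCube dCube') dF)
    (fanoutFn (xorF ∘ fanoutFn dT dCube') dF)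

/-- `dFactor ∈ FP`. [folklore] -/
theorem dFactor_mem_FP : dFactor ∈ FP :=
  comp_mem_FP fmulOpF_mem_FP (fanoutFn_mem_FP
    (comp_mem_FP finvF_mem_FP (fanoutFn_mem_FP (comp_mem_FP xorF_mem_FP (fanoutFn_mem_FP dCube_mem_FP dCube'_mem_FP))
      dAcc_mem_FP.2.2.1))
    (fanoutFn_mem_FP (comp_mem_FP xorF_mem_FP (fanoutFn_mem_FP dAcc_mem_FP.2.1 dCube'_mem_FP)) dAcc_mem_FP.2.2.1))

/-- The unit `1 = 1 0^M` (cut from `f`). [folklore] -/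
def dOne : List Bool → List Bool := appF ∘ fanoutFn (fun _ => [true]) (Kannan.zerosFn ∘ dropFn ∘ fanoutFn (fun _ => [true, true]) dF)

/-- `dOne ∈ FP`. [folklore] -/
theorem dOne_mem_FP : dOne ∈ FP :=
  comp_mem_FP appF_mem_FP (fanoutFn_mem_FP (const_mem_FP _) (comp_mem_FP Kannan.zerosFn_mem_FP (comp_mem_FP dropFn_mem_FP
    (fanoutFn_mem_FP (const_mem_FP _) dAcc_mem_FP.2.2.1))))

/-- **The indicator piece** `⟨(c' = c ? 1 : factor), f⟩`. [folklore] -/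
def deltaPieceF : List Bool → List Bool :=
  fanoutFn (iteFn (eqPairFn ∘ fanoutFn (fstF ∘ padTakeFn ∘ fanoutFn dEta (lenBinF ∘ sndF)) dC) dOne dFactor) dF

/-- `deltaPieceF ∈ FP`. [folklore] -/
theorem deltaPieceF_mem_FP : deltaPieceF ∈ FP :=
  fanoutFn_mem_FP (iteFn_mem_FP (comp_mem_FP eqPairFn_mem_FP (fanoutFn_mem_FP (comp_mem_FP fstF_mem_FP
    (comp_mem_FP padTakeFn_mem_FP (fanoutFn_mem_FP dAcc_mem_FP.2.2.2 (comp_mem_FP lenBinF_mem_FP sndF_mem_FP)))) dAcc_mem_FP.1))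
    dOne_mem_FP dFactor_mem_FP) dAcc_mem_FP.2.2.1

variable (η : ℕ)

/-- The indicator context (generic modulus slot `f`). [folklore] -/
def dCtx (cv : ℕ) (t f R : List Bool) : List Bool :=
  boolPair (boolPair (natBits η cv) t) (boolPair f (boolPair (ones η) R))

/-- Values of the accessors and sub-bricks on the context (`|f| = M + 2`). [folklore] -/
theorem dPieces_apply (cv : ℕ) (t f R : List Bool) (hf : f.length = M + 2) (cv' : ℕ) (hcv' : cv' < 2 ^ η) :
    dC (boolPair (dCtx η cv t f R) (ones cv')) = natBits η cv ∧
    dT (boolPair (dCtx η cv t f R) (ones cv')) = t ∧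
    dF (boolPair (dCtx η cv t f R) (ones cv')) = f ∧
    dEta (boolPair (dCtx η cv t f R) (ones cv')) = ones η ∧
    dCube' (boolPair (dCtx η cv t f R) (ones cv')) = cubeStrN M η cv' ∧
    dCube (boolPair (dCtx η cv t f R) (ones cv')) = cubeStrN M η cv ∧
    dOne (boolPair (dCtx η cv t f R) (ones cv')) = true :: List.replicate M false := by
  have h1 : dC (boolPair (dCtx η cv t f R) (ones cv')) = natBits η cv := by simp [dC, dCtx]
  have h2 : dT (boolPair (dCtx η cv t f R) (ones cv')) = t := by simp [dT, dCtx]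
  have h3 : dF (boolPair (dCtx η cv t f R) (ones cv')) = f := by simp [dF, dCtx]
  have h4 : dEta (boolPair (dCtx η cv t f R) (ones cv')) = ones η := by simp [dEta, dCtx]
  have hpad : dPad (boolPair (dCtx η cv t f R) (ones cv')) = List.replicate (M + 1 - η) false := by
    simp only [dPad, Function.comp_apply, fanoutFn_apply, h4, h3, appF_boolPair, dropFn_boolPair, Kannan.zerosFn_apply,
      List.length_drop, hf, ones, List.length_append, List.length_replicate, List.length_singleton]
    rw [show M + 2 - (η + 1) = M + 1 - η by omega]
  refine ⟨h1, h2, h3, h4, ?_, ?_, ?_⟩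
  · simp only [dCube', Function.comp_apply, fanoutFn_apply, h4, hpad, sndF_boolPair, lenBinF_apply, ones, List.length_replicate,
      padTakeFn_boolPair, fstF_boolPair, appF_boolPair, PRGDerand.takeD_encodeNat_eq_natBits hcv', cubeStrN]
  · simp only [dCube, Function.comp_apply, fanoutFn_apply, h1, hpad, appF_boolPair, cubeStrN]
  · simp only [dOne, Function.comp_apply, fanoutFn_apply, h3, dropFn_boolPair, Kannan.zerosFn_apply, List.length_drop, hf,
      appF_boolPair, List.length_cons, List.length_nil, List.singleton_append]
    rw [show M + 2 - (0 + 1 + 1) = M by omega]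

/-- **Value of the indicator piece.** [folklore] -/
theorem deltaPieceF_apply (hη : η ≤ M + 1) {cv : ℕ} (hcv : cv < 2 ^ η) (t : GF2 M) (R : List Bool)
    {cv' : ℕ} (hcv' : cv' < 2 ^ η) :
    deltaPieceF (boolPair (dCtx η cv (bits M t) (modStr M) R) (ones cv')) =
      boolPair (if cv' = cv then bits M 1 else deltaFactor M η cv cv' (bits M t)) (modStr M) := by
  obtain ⟨h1, h2, h3, h4, h5, h6, h7⟩ := dPieces_apply M η cv (bits M t) (modStr M) R (modStr_top M).1 cv' hcv'
  have hc : (eqPairFn ∘ fanoutFn (fstF ∘ padTakeFn ∘ fanoutFn dEta (lenBinF ∘ sndF)) dC)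
      (boolPair (dCtx η cv (bits M t) (modStr M) R) (ones cv')) = [decide (cv' = cv)] := by
    simp only [Function.comp_apply, fanoutFn_apply, h4, h1, sndF_boolPair, lenBinF_apply, ones, List.length_replicate,
      padTakeFn_boolPair, fstF_boolPair, PRGDerand.takeD_encodeNat_eq_natBits hcv', eqPairFn_boolPair]
    have : (natBits η cv' = natBits η cv) ↔ cv' = cv := by
      constructor
      · intro h
        have := congrArg bitsToNat h
        rwa [bitsToNat_natBits hcv', bitsToNat_natBits hcv] at this
      · rintro rfl; rfl
    rw [Bool.decide_congr this]
  rw [deltaPieceF, fanoutFn_apply, iteFn_apply hc, h3]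
  by_cases h : cv' = cv
  · rw [if_pos (decide_eq_true h), if_pos h, h7, bits_one]
  · rw [if_neg (by simpa using h), if_neg h]
    simp only [dFactor, Function.comp_apply, fanoutFn_apply, h6, h5, h2, h3, xorF_apply, deltaFactor]
    rw [cubeStrN_eq M η hη, cubeStrN_eq M η hη, xorStr_bits, finvF_eq_finvStr, fmulOpF_apply_mod]

/-- The counter `encodeNat 2^η` and the initial accumulator `1` of the indicator fold, on the context. [folklore] -/
def deltaInitF : List Bool → List Bool :=
  fanoutFn (fun w => w) (fanoutFn ((fun w => Kannan.zerosFn w ++ [true]) ∘ fstF ∘ sndF ∘ sndF)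
    (fanoutFn (fun _ => []) (appF ∘ fanoutFn (fun _ => [true])
      (Kannan.zerosFn ∘ dropFn ∘ fanoutFn (fun _ => [true, true]) (fstF ∘ sndF)))))

/-- `deltaInitF ∈ FP`. [folklore] -/
theorem deltaInitF_mem_FP : deltaInitF ∈ FP :=
  fanoutFn_mem_FP (PolyTimeComputable.id _) (fanoutFn_mem_FP
    (comp_mem_FP (append_mem_FP Kannan.zerosFn_mem_FP (const_mem_FP _)) (comp_mem_FP fstF_mem_FP (comp_mem_FP sndF_mem_FP sndF_mem_FP)))
    (fanoutFn_mem_FP (const_mem_FP _) (comp_mem_FP appF_mem_FP (fanoutFn_mem_FP (const_mem_FP _)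
      (comp_mem_FP Kannan.zerosFn_mem_FP (comp_mem_FP dropFn_mem_FP (fanoutFn_mem_FP (const_mem_FP _)
        (comp_mem_FP fstF_mem_FP sndF_mem_FP))))))))

/-- Value of the initialisation (`|f| = M + 2`). [folklore] -/
theorem deltaInitF_apply (cv : ℕ) (t f R : List Bool) (hf : f.length = M + 2) :
    deltaInitF (dCtx η cv t f R) = boolPair (dCtx η cv t f R) (boolPair (encodeNat (2 ^ η))
      (boolPair [] (true :: List.replicate M false))) := by
  simp only [deltaInitF, fanoutFn_apply, Function.comp_apply, dCtx, sndF_boolPair, fstF_boolPair, Kannan.zerosFn_apply, ones,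
    List.length_replicate, zeros_append_true_eq_encodeNat, dropFn_boolPair, List.length_drop, hf, appF_boolPair,
    List.length_cons, List.length_nil, List.singleton_append]
  rw [show M + 2 - (0 + 1 + 1) = M by omega]

/-- **The indicator brick** `deltaF`: the product of the `2^η` indicator pieces. [folklore] -/
def deltaF : List Bool → List Bool := sndPow 2 ∘ foldLoop fmulOpF (clipF 3 deltaPieceF) X ∘ deltaInitF

/-- `deltaF ∈ FP`. [folklore] -/
theorem deltaF_mem_FP : deltaF ∈ FP :=
  comp_mem_FP (sndPow_mem_FP 2) (comp_mem_FP
    (foldLoop_clipF_mem_FP 3 fmulOpF_mem_FP length_fmulOpF_le deltaPieceF_mem_FP _) deltaInitF_mem_FP)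

/-- **Value of the indicator brick**: `δ_c(t)` on bits. [folklore] -/
theorem deltaF_apply (hM : 1 ≤ M) (hη : η ≤ M + 1) {cv : ℕ} (hcv : cv < 2 ^ η) (t : GF2 M) (R : List Bool)
    (hR : 2 ^ η ≤ R.length) :
    deltaF (dCtx η cv (bits M t) (modStr M) R) = deltaStr M η cv (bits M t) := by
  have hf := (modStr_top M).1
  have hk : 2 ^ η ≤ (X : Polynomial ℕ).eval (dCtx η cv (bits M t) (modStr M) R).length := by
    simp only [eval_X, dCtx, length_boolPair]; omega
  have hloop := foldLoop_apply fmulOpF (clipF 3 deltaPieceF) hk 0 (true :: List.replicate M false)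
  rw [show ones 0 = ([] : List Bool) from rfl] at hloop
  rw [deltaF, Function.comp_apply, Function.comp_apply, deltaInitF_apply M η cv _ _ R hf, hloop, sndPow_succ_boolPair,
    sndPow_succ_boolPair, sndPow_zero_boolPair, foldAcc_clipF (fun j _ hj => ?_)]
  · rw [foldAcc_eq_foldl fmulOpF deltaPieceF _ (fun acc p => fmulStr M acc (fstF p))
      (fun cv' => boolPair (if cv' = cv then bits M 1 else deltaFactor M η cv cv' (bits M t)) (modStr M)) _ _ _
      (fun a j _ _ => by rw [fmulOpF_apply_mod, fstF_boolPair]) (fun j _ hj => deltaPieceF_apply M η hη hcv t R (by omega))]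
    rw [deltaStr, List.range_eq_range', ← bits_one]
    simp only [fstF_boolPair]
  · rw [deltaPieceF_apply M η hη hcv t R (by omega), length_boolPair, hf]
    simp only [dCtx, length_boolPair]
    have : (if j = cv then bits M 1 else deltaFactor M η cv j (bits M t)).length = M + 1 := by
      split_ifs
      · exact length_bits M 1
      · rw [deltaFactor, fmulStr, length_pmodStr _ _ hf]
    rw [this]; omega

end Delta

/-! ### B7. The product over the blocks `∏_i δ_{a_i}(z_i)` -/

section Term

variable (η k : ℕ)

/-- The environment `⟨f, ⟨1^η, ⟨1^k, R⟩⟩⟩`. [folklore] -/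
def env (f R : List Bool) : List Bool := boolPair f (boolPair (ones η) (boolPair (ones k) R))

/-- The flattened coordinate blocks `z_0 z_1 ⋯ z_{k-1}` (`M + 1` bits each). [folklore] -/
def zFlat (z : Fin k → GF2 M) : List Bool := (List.ofFn fun i => bits M (z i)).flatten

/-- Block `η`-windows of a `kη`-bit numeral. [folklore] -/
theorem take_drop_natBits (j r : ℕ) (hr : r < k) :
    ((natBits (k * η) j).drop (η * r)).take η = natBits η (blockVal η j r) := by
  have hsplit : k * η = η * r + (η + (k * η - η * r - η)) := by
    have : η * (r + 1) ≤ η * k := Nat.mul_le_mul_left η hr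
    rw [Nat.mul_succ] at this
    have h2 : η * k = k * η := Nat.mul_comm _ _
    omega
  rw [hsplit, NWMachine.natBits_add, List.drop_left' (length_natBits _ _), NWMachine.natBits_add,
    List.take_left' (length_natBits _ _), blockVal, NWMachine.natBits_mod]

/-- Dropping whole windows. [folklore] -/
theorem drop_drop_mul (l : List Bool) (w r : ℕ) : (l.drop (w * r)).drop w = l.drop (w * (r + 1)) := by
  rw [List.drop_drop, Nat.mul_succ]

/-- Windows of the flattened blocks. [folklore] -/
theorem take_drop_zFlat (z : Fin k → GF2 M) (r : ℕ) (hr : r < k) :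
    ((zFlat M k z).drop ((M + 1) * r)).take (M + 1) = bits M (z ⟨r, hr⟩) := by
  -- the flattened list of equal-length blocks, windowed
  have hgen : ∀ (L : List (List Bool)) (r : ℕ) (hr : r < L.length), (∀ b ∈ L, b.length = M + 1) →
      (L.flatten.drop ((M + 1) * r)).take (M + 1) = L[r] := by
    intro L
    induction L with
    | nil => intro r hr; simp at hr
    | cons b L ih =>
      intro r hr hl
      have hb : b.length = M + 1 := hl b (by simp)
      cases r with
      | zero => simp [List.take_left' hb]
      | succ r =>
        rw [List.flatten_cons, Nat.mul_succ, show (M + 1) * r + (M + 1) = b.length + (M + 1) * r by rw [hb]; ring,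
          ← List.drop_drop, List.drop_left, ih r (by simpa using hr) (fun b' hb' => hl b' (by simp [hb'])),
          List.getElem_cons_succ]
  rw [zFlat, hgen _ r (by simpa using hr) (fun b hb => by
    rw [List.mem_ofFn] at hb; obtain ⟨i, rfl⟩ := hb; exact length_bits M _)]
  simp

/-- `zFlat` has length `k (M + 1)`. [folklore] -/
theorem length_zFlat (z : Fin k → GF2 M) : (zFlat M k z).length = k * (M + 1) := by
  rw [zFlat, List.length_flatten, List.map_ofFn]
  simp [Function.comp_def]

/-- The ruler `1^{M+1}` cut from the modulus (first field of the piece `env`). [folklore] -/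
def tRulerM : List Bool → List Bool := dropFn ∘ fanoutFn (fun _ => [true]) (polyFn X ∘ fstF ∘ sndF)
/-- The ruler `1^η` (from the piece `env`). [folklore] -/
def tRulerE : List Bool → List Bool := fstF ∘ sndF ∘ sndF

/-- **The block-product operation** on a state `⟨prod, ⟨aRest, zRest⟩⟩` with piece `env`:
multiply `prod` by `δ_c(t)` for the next windows `c`, `t`, and advance the windows. [folklore] -/
def termOpF : List Bool → List Bool :=
  fanoutFn
    (fmulOpF ∘ fanoutFn (fstF ∘ fstF) (fanoutFn
      (deltaF ∘ fanoutFn (fanoutFn (takeFn ∘ fanoutFn tRulerE (fstF ∘ sndF ∘ fstF))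
        (takeFn ∘ fanoutFn tRulerM (sndF ∘ sndF ∘ fstF))) sndF) (fstF ∘ sndF)))
    (fanoutFn (dropFn ∘ fanoutFn tRulerE (fstF ∘ sndF ∘ fstF)) (dropFn ∘ fanoutFn tRulerM (sndF ∘ sndF ∘ fstF)))

/-- `termOpF ∈ FP`. [folklore] -/
theorem termOpF_mem_FP : termOpF ∈ FP := by
  have hRM : tRulerM ∈ FP := comp_mem_FP dropFn_mem_FP (fanoutFn_mem_FP (const_mem_FP _)
    (comp_mem_FP (polyFn_mem_FP _) (comp_mem_FP fstF_mem_FP sndF_mem_FP)))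
  have hRE : tRulerE ∈ FP := comp_mem_FP fstF_mem_FP (comp_mem_FP sndF_mem_FP sndF_mem_FP)
  have hA : (fstF ∘ sndF ∘ fstF) ∈ FP := comp_mem_FP fstF_mem_FP (comp_mem_FP sndF_mem_FP fstF_mem_FP)
  have hZ : (sndF ∘ sndF ∘ fstF) ∈ FP := comp_mem_FP sndF_mem_FP (comp_mem_FP sndF_mem_FP fstF_mem_FP)
  exact fanoutFn_mem_FP
    (comp_mem_FP fmulOpF_mem_FP (fanoutFn_mem_FP (comp_mem_FP fstF_mem_FP fstF_mem_FP) (fanoutFn_mem_FP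
      (comp_mem_FP deltaF_mem_FP (fanoutFn_mem_FP (fanoutFn_mem_FP (comp_mem_FP takeFn_mem_FP (fanoutFn_mem_FP hRE hA))
        (comp_mem_FP takeFn_mem_FP (fanoutFn_mem_FP hRM hZ))) sndF_mem_FP)) (comp_mem_FP fstF_mem_FP sndF_mem_FP))))
    (fanoutFn_mem_FP (comp_mem_FP dropFn_mem_FP (fanoutFn_mem_FP hRE hA)) (comp_mem_FP dropFn_mem_FP (fanoutFn_mem_FP hRM hZ)))

/-- **Value of the block-product operation on a genuine state** (round `r < k`). [folklore] -/
theorem termOpF_apply (hM : 1 ≤ M) (hη : η ≤ M + 1) (hkη : 2 ^ η ≤ k) (j : ℕ) (z : Fin k → GF2 M) (R : List Bool) (u : GF2 M)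
    {r : ℕ} (hr : r < k) :
    termOpF (boolPair (boolPair (bits M u) (boolPair ((natBits (k * η) j).drop (η * r)) ((zFlat M k z).drop ((M + 1) * r))))
      (env η k (modStr M) R)) =
      boolPair (bits M (u * (MetaComplexity.cubeBasis (SelfCorrect.cubePt η M) (bitsOf η (blockVal η j r))).eval (z ⟨r, hr⟩)))
        (boolPair ((natBits (k * η) j).drop (η * (r + 1))) ((zFlat M k z).drop ((M + 1) * (r + 1)))) := by
  have hf := (modStr_top M).1
  have hRM : ∀ S, tRulerM (boolPair S (env η k (modStr M) R)) = ones (M + 1) := fun S => by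
    simp [tRulerM, env, hf, ones, List.drop_replicate]
  have hRE : ∀ S, tRulerE (boolPair S (env η k (modStr M) R)) = ones η := fun S => by simp [tRulerE, env]
  have hkR : 2 ^ η ≤ (boolPair (ones k) R).length := by
    simp only [length_boolPair, ones, List.length_replicate]; omega
  rw [termOpF, fanoutFn_apply, fanoutFn_apply]
  simp only [Function.comp_apply, fanoutFn_apply, fstF_boolPair, sndF_boolPair, hRM, hRE, takeFn_boolPair, dropFn_boolPair,
    ones, List.length_replicate, take_drop_natBits η k j r hr, take_drop_zFlat M k z r hr, drop_drop_mul]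
  congr 1
  have hctx : boolPair (boolPair (natBits η (blockVal η j r)) (bits M (z ⟨r, hr⟩))) (env η k (modStr M) R) =
      dCtx η (blockVal η j r) (bits M (z ⟨r, hr⟩)) (modStr M) (boolPair (ones k) R) := rfl
  rw [hctx, deltaF_apply M η hM hη (by unfold blockVal; exact Nat.mod_lt _ (Nat.two_pow_pos η)) _ _ hkR,
    deltaStr_eq M η hM hη (by unfold blockVal; exact Nat.mod_lt _ (Nat.two_pow_pos η)), env, fstF_boolPair, fmulOpF_bits]

/-- Growth of the block-product operation on genuine states: the state does not grow. [folklore] -/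
theorem length_termOpF_state (hM : 1 ≤ M) (hη : η ≤ M + 1) (hkη : 2 ^ η ≤ k) (j : ℕ) (z : Fin k → GF2 M) (R : List Bool)
    (u : GF2 M) {r : ℕ} (hr : r < k) :
    (termOpF (boolPair (boolPair (bits M u) (boolPair ((natBits (k * η) j).drop (η * r)) ((zFlat M k z).drop ((M + 1) * r))))
      (env η k (modStr M) R))).length ≤
      (boolPair (bits M u) (boolPair ((natBits (k * η) j).drop (η * r)) ((zFlat M k z).drop ((M + 1) * r)))).length := by
  rw [termOpF_apply M η k hM hη hkη j z R u hr]
  simp only [length_boolPair, length_bits, List.length_drop]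
  have h1 : (natBits (k * η) j).length - η * (r + 1) ≤ (natBits (k * η) j).length - η * r :=
    Nat.sub_le_sub_left (Nat.mul_le_mul_left η (by omega)) _
  have h2 : (zFlat M k z).length - (M + 1) * (r + 1) ≤ (zFlat M k z).length - (M + 1) * r :=
    Nat.sub_le_sub_left (Nat.mul_le_mul_left (M + 1) (by omega)) _
  omega

/-- The initialisation of the block-product fold on `⟨⟨a, Z⟩, env⟩`. [folklore] -/
def termInitF : List Bool → List Bool :=
  fanoutFn (fun w => w) (fanoutFn (lenBinF ∘ fstF ∘ sndF ∘ sndF ∘ sndF) (fanoutFn (fun _ => [])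
    (fanoutFn (appF ∘ fanoutFn (fun _ => [true]) (Kannan.zerosFn ∘ dropFn ∘ fanoutFn (fun _ => [true, true]) (fstF ∘ sndF)))
      fstF)))

/-- `termInitF ∈ FP`. [folklore] -/
theorem termInitF_mem_FP : termInitF ∈ FP :=
  fanoutFn_mem_FP (PolyTimeComputable.id _) (fanoutFn_mem_FP
    (comp_mem_FP lenBinF_mem_FP (comp_mem_FP fstF_mem_FP (comp_mem_FP sndF_mem_FP (comp_mem_FP sndF_mem_FP sndF_mem_FP))))
    (fanoutFn_mem_FP (const_mem_FP _) (fanoutFn_mem_FP (comp_mem_FP appF_mem_FP (fanoutFn_mem_FP (const_mem_FP _)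
      (comp_mem_FP Kannan.zerosFn_mem_FP (comp_mem_FP dropFn_mem_FP (fanoutFn_mem_FP (const_mem_FP _)
        (comp_mem_FP fstF_mem_FP sndF_mem_FP)))))) fstF_mem_FP)))

/-- Value of the initialisation. [folklore] -/
theorem termInitF_apply (A f R : List Bool) (hf : f.length = M + 2) :
    termInitF (boolPair A (env η k f R)) = boolPair (boolPair A (env η k f R)) (boolPair (encodeNat k)
      (boolPair [] (boolPair (true :: List.replicate M false) A))) := by
  simp only [termInitF, fanoutFn_apply, Function.comp_apply, env, sndF_boolPair, fstF_boolPair, lenBinF_apply, ones,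
    List.length_replicate, dropFn_boolPair, Kannan.zerosFn_apply, List.length_drop, hf, appF_boolPair, List.length_cons,
    List.length_nil, List.singleton_append]
  rw [show M + 2 - (0 + 1 + 1) = M by omega]

/-- **The block-product brick** `termF ⟨⟨a, Z⟩, env⟩`: `k` rounds of `termOpF`, then the product. [folklore] -/
def termF : List Bool → List Bool := fstF ∘ sndPow 2 ∘ foldLoop (clipOp termOpF) (clipF 1 (sndF ∘ fstF)) X ∘ termInitF

/-- `termF ∈ FP`. [folklore] -/
theorem termF_mem_FP : termF ∈ FP :=
  comp_mem_FP fstF_mem_FP (comp_mem_FP (sndPow_mem_FP 2) (comp_mem_FP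
    (foldLoop_clipF_mem_FP 1 (clipOp_mem_FP termOpF_mem_FP) (length_clipOp_le termOpF) (comp_mem_FP sndF_mem_FP fstF_mem_FP) _)
    termInitF_mem_FP))

/-- The factors, indexed by block number (`1` past the last block). [folklore] -/
def factorOf (j : ℕ) (z : Fin k → GF2 M) (i : ℕ) : GF2 M :=
  if h : i < k then (MetaComplexity.cubeBasis (SelfCorrect.cubePt η M) (bitsOf η (blockVal η j i))).eval (z ⟨i, h⟩) else 1

/-- **Value of the block-product brick**: `∏_{i<k} δ_{a_i}(z_i)` on bits. [folklore] -/
theorem termF_apply (hM : 1 ≤ M) (hη : η ≤ M + 1) (hkη : 2 ^ η ≤ k) (j : ℕ) (z : Fin k → GF2 M) (R : List Bool) :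
    termF (boolPair (boolPair (natBits (k * η) j) (zFlat M k z)) (env η k (modStr M) R)) =
      bits M (∏ i ∈ Finset.range k, factorOf M η k j z i) := by
  have hf := (modStr_top M).1
  set x := boolPair (boolPair (natBits (k * η) j) (zFlat M k z)) (env η k (modStr M) R) with hx
  have hk : k ≤ (X : Polynomial ℕ).eval x.length := by
    simp only [eval_X, hx, env, length_boolPair, ones, List.length_replicate]; omega
  have hloop := foldLoop_apply (clipOp termOpF) (clipF 1 (sndF ∘ fstF)) hk 0
    (boolPair (true :: List.replicate M false) (boolPair (natBits (k * η) j) (zFlat M k z)))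
  rw [show ones 0 = ([] : List Bool) from rfl] at hloop
  rw [termF, Function.comp_apply, Function.comp_apply, Function.comp_apply, hx, termInitF_apply M η k _ _ R hf, ← hx, hloop,
    sndPow_succ_boolPair, sndPow_succ_boolPair, sndPow_zero_boolPair,
    foldAcc_clipF (fun i _ _ => by simp [hx, length_boolPair]; omega)]
  -- the invariant
  have hgen : ∀ r t : ℕ, t + r ≤ k → foldAcc (clipOp termOpF) (sndF ∘ fstF) x t r
      (boolPair (bits M (∏ i ∈ Finset.range t, factorOf M η k j z i))
        (boolPair ((natBits (k * η) j).drop (η * t)) ((zFlat M k z).drop ((M + 1) * t)))) =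
      boolPair (bits M (∏ i ∈ Finset.range (t + r), factorOf M η k j z i))
        (boolPair ((natBits (k * η) j).drop (η * (t + r))) ((zFlat M k z).drop ((M + 1) * (t + r)))) := by
    intro r
    induction r with
    | zero => intro t _; simp only [foldAcc_zero, add_zero]
    | succ r ih =>
      intro t htr
      have ht : t < k := by omega
      rw [foldAcc_succ]
      have hp : (sndF ∘ fstF) (boolPair x (ones t)) = env η k (modStr M) R := by simp [hx]
      rw [hp, clipOp_eq (by
        rw [fstF_boolPair, sndF_boolPair]
        exact (length_termOpF_state M η k hM hη hkη j z R _ ht).trans (Nat.le_add_right _ _)),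
        termOpF_apply M η k hM hη hkη j z R _ ht]
      have e1 : (∏ i ∈ Finset.range t, factorOf M η k j z i) *
          (MetaComplexity.cubeBasis (SelfCorrect.cubePt η M) (bitsOf η (blockVal η j t))).eval (z ⟨t, ht⟩) =
          ∏ i ∈ Finset.range (t + 1), factorOf M η k j z i := by
        rw [Finset.prod_range_succ, factorOf, dif_pos ht]
      rw [e1, ih (t + 1) (by omega), show t + (r + 1) = t + 1 + r by omega]
  have := hgen k 0 (by omega)
  simp only [zero_add, Finset.range_zero, Finset.prod_empty, mul_zero, List.drop_zero] at this
  rw [← bits_one, this, fstF_boolPair]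

end Term

/-! ### B8. The sum over the cube: the extension `P(z)` with the language as an oracle -/

section Ext

variable (η k : ℕ) (e : List Bool) (Q : Polynomial ℕ)

/-- **Unary multiplication** `umulF ⟨1ᵏ, 1^η⟩ = 1^{kη}` (concatenate `1^η`, `k` rounds). [folklore] -/
def umulF : List Bool → List Bool :=
  sndPow 2 ∘ foldLoop appF (clipF 1 (sndF ∘ fstF)) X ∘ fanoutFn (fun w => w) (fanoutFn (lenBinF ∘ fstF) fun _ => boolPair [] [])

/-- `umulF ∈ FP`. [folklore] -/
theorem umulF_mem_FP : umulF ∈ FP :=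
  comp_mem_FP (sndPow_mem_FP 2) (comp_mem_FP
    (foldLoop_clipF_mem_FP 1 appF_mem_FP length_appF_le (comp_mem_FP sndF_mem_FP fstF_mem_FP) _)
    (fanoutFn_mem_FP (PolyTimeComputable.id _) (fanoutFn_mem_FP (comp_mem_FP lenBinF_mem_FP fstF_mem_FP) (const_mem_FP _))))

/-- Concatenating a constant block. [folklore] -/
theorem ccat_const_ones (η : ℕ) : ∀ k, ccat (fun _ => ones η) k = ones (k * η)
  | 0 => by simp [ones]
  | k + 1 => by rw [ccat_succ, ccat_const_ones η k, Nat.succ_mul, ones, ones, ones, List.replicate_add]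

/-- **Value of unary multiplication.** [folklore] -/
theorem umulF_apply (k η : ℕ) : umulF (boolPair (ones k) (ones η)) = ones (k * η) := by
  have hk : k ≤ (X : Polynomial ℕ).eval (boolPair (ones k) (ones η)).length := by
    simp only [eval_X, length_boolPair, ones, List.length_replicate]; omega
  have hloop := foldLoop_apply appF (clipF 1 (sndF ∘ fstF)) hk 0 []
  rw [show ones 0 = ([] : List Bool) from rfl] at hloop
  simp only [umulF, Function.comp_apply, fanoutFn_apply, lenBinF_apply, fstF_boolPair]
  simp only [ones, List.length_replicate] at hloop ⊢
  rw [hloop, sndPow_succ_boolPair, sndPow_succ_boolPair, sndPow_zero_boolPair,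
    foldAcc_clipF (fun j _ _ => by simp [length_boolPair]; omega), foldAcc_appF]
  simp only [List.nil_append, Function.comp_apply, fstF_boolPair, sndF_boolPair]
  have := ccat_const_ones η k
  simp only [ones] at this
  exact this

/-- The cube function read through a string predicate `G` (row-major listing of the cube point). [folklore] -/
def cubeFnOf (G : List Bool → Bool) (a : Fin k → Fin η → Bool) : Bool :=
  G (List.ofFn fun p : Fin (k * η) => a (finProdFinEquiv.symm p).1 (finProdFinEquiv.symm p).2)

/-- On the cube point of a bit string, `cubeFnOf G` reads the string. [folklore] -/
theorem cubeFnOf_rows (G : List Bool → Bool) (u : Fin (k * η) → Bool) :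
    cubeFnOf η k G (SelfCorrect.rows k η u) = G (List.ofFn u) := by
  unfold cubeFnOf SelfCorrect.rows
  congr 2
  funext p
  have : finProdFinEquiv (p.divNat, p.modNat) = p := finProdFinEquiv.apply_symm_apply p
  simp [this]

/-- **The cube-point piece** on `⟨⟨⟨Z, env⟩, ⟨1ⁿ, P⟩⟩, 1ʲ⟩` (`n = kη`, `P = 1^N` the pad): the block
product of the cube point `a = natBits n j` if the oracle says `a ∈ L`, else `[]`. [folklore] -/
def aStrF : List Bool → List Bool := fstF ∘ padTakeFn ∘ fanoutFn (fstF ∘ sndF ∘ fstF) (lenBinF ∘ sndF)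

/-- `aStrF ∈ FP`. [folklore] -/
theorem aStrF_mem_FP : aStrF ∈ FP :=
  comp_mem_FP fstF_mem_FP (comp_mem_FP padTakeFn_mem_FP (fanoutFn_mem_FP
    (comp_mem_FP fstF_mem_FP (comp_mem_FP sndF_mem_FP fstF_mem_FP)) (comp_mem_FP lenBinF_mem_FP sndF_mem_FP)))

/-- Value of the cube-point numeral `aStrF ⟨⟨⟨Z, env⟩, ⟨1ⁿ, P⟩⟩, 1ʲ⟩ = natBits n j` (`j < 2ⁿ`). [folklore] -/
theorem aStrF_apply (Z envS P : List Bool) {n j : ℕ} (hj : j < 2 ^ n) :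
    aStrF (boolPair (boolPair (boolPair Z envS) (boolPair (ones n) P)) (ones j)) = natBits n j := by
  simp [aStrF, ones, PRGDerand.takeD_encodeNat_eq_natBits hj]

/-- **The cube-point piece** (see `extPieceF_apply`). [folklore] -/
def extPieceF : List Bool → List Bool :=
  iteFn (NWMachine.evalF e Q ∘ fanoutFn aStrF (fanoutFn (sndF ∘ sndF ∘ fstF) fun _ => []))
    (termF ∘ fanoutFn (fanoutFn aStrF (fstF ∘ fstF ∘ fstF)) (sndF ∘ fstF ∘ fstF))
    fun _ => []

/-- `extPieceF ∈ FP`. [folklore] -/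
theorem extPieceF_mem_FP : extPieceF e Q ∈ FP :=
  iteFn_mem_FP (comp_mem_FP (NWMachine.evalF_mem_FP e Q) (fanoutFn_mem_FP aStrF_mem_FP (fanoutFn_mem_FP
      (comp_mem_FP sndF_mem_FP (comp_mem_FP sndF_mem_FP fstF_mem_FP)) (const_mem_FP _))))
    (comp_mem_FP termF_mem_FP (fanoutFn_mem_FP (fanoutFn_mem_FP aStrF_mem_FP (comp_mem_FP fstF_mem_FP (comp_mem_FP fstF_mem_FP fstF_mem_FP)))
      (comp_mem_FP sndF_mem_FP (comp_mem_FP fstF_mem_FP fstF_mem_FP)))) (const_mem_FP _)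

/-- The cube-sum context. [folklore] -/
def eCtx (Z envS P : List Bool) : List Bool := boolPair (boolPair Z envS) (boolPair (ones (k * η)) P)

/-- **Value of the cube-point piece** (oracle answering `G` within budget `Q(N)` on `n`-bit strings). [folklore] -/
theorem extPieceF_apply (hM : 1 ≤ M) (hη : η ≤ M + 1) (hkη : 2 ^ η ≤ k) (z : Fin k → GF2 M) (R : List Bool)
    {N : ℕ} (G : List Bool → Bool) (hrun : ∀ u : List Bool, u.length = k * η → ClockedUS.run (boolPair e u) (Q.eval N) = some [G u])
    {j : ℕ} (hj : j < 2 ^ (k * η)) :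
    extPieceF e Q (boolPair (eCtx η k (zFlat M k z) (env η k (modStr M) R) (ones N)) (ones j)) =
      if G (natBits (k * η) j) then bits M (∏ i ∈ Finset.range k, factorOf M η k j z i) else [] := by
  have ha := aStrF_apply (zFlat M k z) (env η k (modStr M) R) (ones N) hj
  have hc : (NWMachine.evalF e Q ∘ fanoutFn aStrF (fanoutFn (sndF ∘ sndF ∘ fstF) fun _ => []))
      (boolPair (eCtx η k (zFlat M k z) (env η k (modStr M) R) (ones N)) (ones j)) = [G (natBits (k * η) j)] := by
    rw [Function.comp_apply, fanoutFn_apply, eCtx, ha]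
    simp only [fanoutFn_apply, Function.comp_apply, fstF_boolPair, sndF_boolPair]
    exact NWMachine.evalF_apply e Q (hrun _ (length_natBits _ _))
  rw [extPieceF, iteFn_apply hc]
  split_ifs with h
  · rw [Function.comp_apply, fanoutFn_apply, fanoutFn_apply, eCtx, ha]
    simp only [Function.comp_apply, fstF_boolPair, sndF_boolPair]
    exact termF_apply M η k hM hη hkη j z R
  · rfl

/-- The initialisation of the cube sum on the context: counter `encodeNat 2ⁿ`, accumulator `0^{M+1}`. [folklore] -/
def extInitF : List Bool → List Bool :=
  fanoutFn (fun w => w) (fanoutFn ((fun w => Kannan.zerosFn w ++ [true]) ∘ fstF ∘ sndF)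
    (fanoutFn (fun _ => []) (Kannan.zerosFn ∘ dropFn ∘ fanoutFn (fun _ => [true]) (fstF ∘ sndF ∘ fstF))))

/-- `extInitF ∈ FP`. [folklore] -/
theorem extInitF_mem_FP : extInitF ∈ FP :=
  fanoutFn_mem_FP (PolyTimeComputable.id _) (fanoutFn_mem_FP
    (comp_mem_FP (append_mem_FP Kannan.zerosFn_mem_FP (const_mem_FP _)) (comp_mem_FP fstF_mem_FP sndF_mem_FP))
    (fanoutFn_mem_FP (const_mem_FP _) (comp_mem_FP Kannan.zerosFn_mem_FP (comp_mem_FP dropFn_mem_FP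
      (fanoutFn_mem_FP (const_mem_FP _) (comp_mem_FP fstF_mem_FP (comp_mem_FP sndF_mem_FP fstF_mem_FP)))))))

/-- Value of the initialisation (`|f| = M + 2`). [folklore] -/
theorem extInitF_apply (Z f R P : List Bool) (hf : f.length = M + 2) :
    extInitF (eCtx η k Z (env η k f R) P) = boolPair (eCtx η k Z (env η k f R) P)
      (boolPair (encodeNat (2 ^ (k * η))) (boolPair [] (List.replicate (M + 1) false))) := by
  simp only [extInitF, fanoutFn_apply, Function.comp_apply, eCtx, env, sndF_boolPair, fstF_boolPair, Kannan.zerosFn_apply, ones,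
    List.length_replicate, zeros_append_true_eq_encodeNat, dropFn_boolPair, List.length_drop, hf, List.length_singleton]
  rw [show M + 2 - 1 = M + 1 by omega]

/-- **The cube-sum brick** `extF`: xor-accumulate the cube-point pieces over all `2ⁿ` cube points. [folklore] -/
def extF : List Bool → List Bool := sndPow 2 ∘ foldLoop xorF (clipF 1 (extPieceF e Q)) X ∘ extInitF

/-- `extF ∈ FP`. [folklore] -/
theorem extF_mem_FP : extF e Q ∈ FP :=
  comp_mem_FP (sndPow_mem_FP 2) (comp_mem_FP
    (foldLoop_clipF_mem_FP 1 xorF_mem_FP length_xorF_le (extPieceF_mem_FP e Q) _) extInitF_mem_FP)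

/-- **Value of the cube-sum brick**: the bits of the extension `P(z)` of the cube function
`cubeFnOf G` (`N ≥ 2ⁿ` so that the pad pays for the `2ⁿ` rounds). [cite: AroraBarakCC2009, §19.4.2] -/
theorem extF_apply (hM : 1 ≤ M) (hη : η ≤ M + 1) (hkη : 2 ^ η ≤ k) (z : Fin k → GF2 M) (R : List Bool)
    {N : ℕ} (hN : 2 ^ (k * η) ≤ N) (G : List Bool → Bool)
    (hrun : ∀ u : List Bool, u.length = k * η → ClockedUS.run (boolPair e u) (Q.eval N) = some [G u]) :
    extF e Q (eCtx η k (zFlat M k z) (env η k (modStr M) R) (ones N)) = bits M (SelfCorrect.ext (cubeFnOf η k G) z) := by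
  have hf := (modStr_top M).1
  set x := eCtx η k (zFlat M k z) (env η k (modStr M) R) (ones N) with hx
  have hk : 2 ^ (k * η) ≤ (X : Polynomial ℕ).eval x.length := by
    simp only [eval_X, hx, eCtx, length_boolPair, ones, List.length_replicate]; omega
  have hloop := foldLoop_apply xorF (clipF 1 (extPieceF e Q)) hk 0 (List.replicate (M + 1) false)
  rw [show ones 0 = ([] : List Bool) from rfl] at hloop
  have hpiece : ∀ j, j < 2 ^ (k * η) → extPieceF e Q (boolPair x (ones j)) =
      if G (natBits (k * η) j) then bits M (∏ i ∈ Finset.range k, factorOf M η k j z i) else [] :=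
    fun j hj => by rw [hx]; exact extPieceF_apply M η k e Q hM hη hkη z R G hrun hj
  rw [extF, Function.comp_apply, Function.comp_apply, hx, extInitF_apply M η k _ _ R _ hf, ← hx, hloop, sndPow_succ_boolPair,
    sndPow_succ_boolPair, sndPow_zero_boolPair, foldAcc_clipF (fun j _ hj => by
      rw [hpiece j (by omega)]
      split_ifs
      · rw [length_bits]; simp only [hx, eCtx, env, length_boolPair]; omega
      · simp)]
  rw [foldAcc_eq_foldl xorF (extPieceF e Q) x xorStr
    (fun j => if G (natBits (k * η) j) then bits M (∏ i ∈ Finset.range k, factorOf M η k j z i) else []) _ _ _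
    (fun a j _ _ => xorF_apply _ _) (fun j _ hj => hpiece j (by omega))]
  -- the xor-accumulation computes the sum of the terms
  set T : ℕ → GF2 M := fun j => SelfCorrect.bitF M (cubeFnOf η k G (SelfCorrect.rows k η (bitsOf (k * η) j))) *
    ∏ i : Fin k, (MetaComplexity.cubeBasis (SelfCorrect.cubePt η M) (SelfCorrect.rows k η (bitsOf (k * η) j) i)).eval (z i) with hT
  have hterm : ∀ j, (∏ i ∈ Finset.range k, factorOf M η k j z i) =
      ∏ i : Fin k, (MetaComplexity.cubeBasis (SelfCorrect.cubePt η M) (SelfCorrect.rows k η (bitsOf (k * η) j) i)).eval (z i) := by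
    intro j
    rw [← Fin.prod_univ_eq_prod_range]
    refine Fintype.prod_congr _ _ fun i => ?_
    rw [factorOf, dif_pos i.isLt, rows_bitsOf]
  have hfold : ∀ n, (List.range' 0 n).foldl (fun acc j => xorStr acc
      (if G (natBits (k * η) j) then bits M (∏ i ∈ Finset.range k, factorOf M η k j z i) else []))
      (List.replicate (M + 1) false) = bits M (∑ j ∈ Finset.range n, T j) := by
    intro n
    induction n with
    | zero => rw [List.range'_zero, List.foldl_nil, Finset.sum_range_zero, bits_zero]
    | succ n ih =>
      rw [List.range'_1_concat, List.foldl_append, List.foldl_cons, List.foldl_nil, ih, Finset.sum_range_succ, Nat.zero_add]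
      have hG : G (natBits (k * η) n) = cubeFnOf η k G (SelfCorrect.rows k η (bitsOf (k * η) n)) := by
        rw [cubeFnOf_rows, ofFn_bitsOf]
      by_cases hg : G (natBits (k * η) n) = true
      · rw [if_pos hg, hterm, xorStr_bits]
        congr 2
        rw [hT]; simp only [← hG, hg, SelfCorrect.bitF, if_true, one_mul]
      · rw [if_neg hg, xorStr_nil_right]
        congr 1
        rw [hT]; simp only [Bool.not_eq_true] at hg; simp only [← hG, hg, SelfCorrect.bitF]; simp
  rw [hfold, SelfCorrect.ext, MetaComplexity.lowDegExt]
  congr 1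
  exact sum_range_rows_bitsOf η k (fun a => SelfCorrect.bitF M (cubeFnOf η k G a) *
    ∏ i : Fin k, (MetaComplexity.cubeBasis (SelfCorrect.cubePt η M) (a i)).eval (z i))

end Ext

/-! ### B9. The top level: parsing the padded input, the scale, the one-hot selection -/

section Top

/-- **The pad reader**: emits the leading ones of the input and stops at the first `0`
(`padT (1ᴿ 0 s) = 1ᴿ`). [folklore] -/
def padT : FST Bool Bool Bool where
  init := true
  step := fun st b => if st && b then (true, [true]) else (false, [])
  front := fun _ => []
  keep := fun _ => true

/-- **The payload reader**: skips the leading ones and the first `0`, then copies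
(`restT (1ᴿ 0 s) = s`). [folklore] -/
def restT : FST Bool Bool Bool where
  init := true
  step := fun st b => if st then (if b then (true, []) else (false, [])) else (false, [b])
  front := fun _ => []
  keep := fun _ => true

/-- Transitions of the pad reader. [folklore] -/
theorem padT_step : padT.step true true = (true, [true]) ∧ padT.step true false = (false, []) ∧
    ∀ b, padT.step false b = (false, []) := ⟨rfl, rfl, fun b => by cases b <;> rfl⟩

/-- Transitions of the payload reader. [folklore] -/
theorem restT_step : restT.step true true = (true, []) ∧ restT.step true false = (false, []) ∧
    ∀ b, restT.step false b = (false, [b]) := ⟨rfl, rfl, fun _ => rfl⟩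

/-- Value of the pad reader. [folklore] -/
theorem padT_eval (R : ℕ) (s : List Bool) : padT.eval (ones R ++ false :: s) = ones R := by
  have hdone : ∀ l : List Bool, padT.run false l = (false, []) := by
    intro l; induction l with
    | nil => rfl
    | cons b l ih => rw [FST.run_cons, padT_step.2.2 b, ih]; rfl
  have h : ∀ R : ℕ, padT.run true (ones R ++ false :: s) = (false, ones R) := by
    intro R; induction R with
    | zero => rw [ones, List.replicate_zero, List.nil_append, FST.run_cons, padT_step.2.1, hdone]; rfl
    | succ R ih =>
      rw [show ones (R + 1) ++ false :: s = true :: (ones R ++ false :: s) by simp [ones, List.replicate_succ], FST.run_cons,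
        padT_step.1, ih]
      simp [ones, List.replicate_succ]
  rw [FST.eval, show padT.init = true from rfl, h]
  rfl

/-- Value of the payload reader. [folklore] -/
theorem restT_eval (R : ℕ) (s : List Bool) : restT.eval (ones R ++ false :: s) = s := by
  have hcopy : ∀ l : List Bool, restT.run false l = (false, l) := by
    intro l; induction l with
    | nil => rfl
    | cons b l ih => rw [FST.run_cons, restT_step.2.2 b, ih]; rfl
  have h : ∀ R : ℕ, restT.run true (ones R ++ false :: s) = (false, s) := by
    intro R; induction R with
    | zero => rw [ones, List.replicate_zero, List.nil_append, FST.run_cons, restT_step.2.1, hcopy]; rfl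
    | succ R ih =>
      rw [show ones (R + 1) ++ false :: s = true :: (ones R ++ false :: s) by simp [ones, List.replicate_succ], FST.run_cons,
        restT_step.1, ih]
      rfl
  rw [FST.eval, show restT.init = true from rfl, h]
  rfl

/-- The numeral of `lenOf η' = 2^{η'}(2η'+2) + (2η'+2)` from `1^{η'}` (second field of `⟨x, 1^{η'}⟩`). [folklore] -/
def lenNumF : List Bool → List Bool :=
  addFn ∘ fanoutFn
    (prodFn ∘ fanoutFn ((fun w => Kannan.zerosFn w ++ [true]) ∘ sndF)
      (lenBinF ∘ (fun w => w ++ [true, true]) ∘ appF ∘ fanoutFn sndF sndF))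
    (lenBinF ∘ (fun w => w ++ [true, true]) ∘ appF ∘ fanoutFn sndF sndF)

/-- `lenNumF ∈ FP`. [folklore] -/
theorem lenNumF_mem_FP : lenNumF ∈ FP := by
  have h2 : (lenBinF ∘ (fun w => w ++ [true, true]) ∘ appF ∘ fanoutFn sndF sndF) ∈ FP :=
    comp_mem_FP lenBinF_mem_FP (comp_mem_FP (append_mem_FP (PolyTimeComputable.id _) (const_mem_FP _))
      (comp_mem_FP appF_mem_FP (fanoutFn_mem_FP sndF_mem_FP sndF_mem_FP)))
  exact comp_mem_FP addFn_mem_FP (fanoutFn_mem_FP (comp_mem_FP prodFn_mem_FP (fanoutFn_mem_FP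
    (comp_mem_FP (append_mem_FP Kannan.zerosFn_mem_FP (const_mem_FP _)) sndF_mem_FP) h2)) h2)

/-- Value of `lenNumF`. [folklore] -/
theorem lenNumF_apply (x : List Bool) (η' : ℕ) : lenNumF (boolPair x (ones η')) = encodeNat (MildHard.lenOf η') := by
  simp only [lenNumF, Function.comp_apply, fanoutFn_apply, sndF_boolPair, Kannan.zerosFn_apply, ones, List.length_replicate,
    zeros_append_true_eq_encodeNat, appF_boolPair, lenBinF_apply, List.length_append, prodFn_boolPair, bitsToNat_encodeNat,
    addFn_boolPair, MildHard.lenOf, MildHard.kOf, MildHard.MOf, List.length_cons, List.length_nil]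
  congr 1; ring

/-- **The scale piece** on `⟨x, 1^{η'}⟩`: `1 1^{η'}` if `lenOf η' ≤ |x|`, else `[]`. [folklore] -/
def etaPieceF : List Bool → List Bool :=
  iteFn (notFn (ltFn ∘ fanoutFn (lenBinF ∘ fstF) lenNumF)) (List.cons true ∘ sndF) fun _ => []

/-- `etaPieceF ∈ FP`. [folklore] -/
theorem etaPieceF_mem_FP : etaPieceF ∈ FP :=
  iteFn_mem_FP (notFn_mem_FP (comp_mem_FP ltFn_mem_FP (fanoutFn_mem_FP (comp_mem_FP lenBinF_mem_FP fstF_mem_FP) lenNumF_mem_FP)))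
    (comp_mem_FP (cons_mem_FP true) sndF_mem_FP) (const_mem_FP _)

/-- Value of the scale piece. [folklore] -/
theorem etaPieceF_apply (x : List Bool) (η' : ℕ) :
    etaPieceF (boolPair x (ones η')) = if MildHard.lenOf η' ≤ x.length then true :: ones η' else [] := by
  have hc : notFn (ltFn ∘ fanoutFn (lenBinF ∘ fstF) lenNumF) (boolPair x (ones η')) = [!decide (x.length < MildHard.lenOf η')] :=
    notFn_apply (by simp only [Function.comp_apply, fanoutFn_apply, fstF_boolPair, lenBinF_apply, lenNumF_apply, ltFn_boolPair,
      bitsToNat_encodeNat])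
  rw [etaPieceF, iteFn_apply hc]
  by_cases h : MildHard.lenOf η' ≤ x.length
  · rw [if_pos h, if_pos (by simpa using h), Function.comp_apply, sndF_boolPair]
  · rw [if_neg h, if_neg (by simpa using h)]

/-- **The keep-last operation** `keepOpF ⟨acc, piece⟩ = if piece = [] then acc else piece`. [folklore] -/
def keepOpF : List Bool → List Bool := iteFn (isNilFn ∘ sndF) fstF sndF

/-- `keepOpF ∈ FP`. [folklore] -/
theorem keepOpF_mem_FP : keepOpF ∈ FP := iteFn_mem_FP (comp_mem_FP isNilFn_mem_FP sndF_mem_FP) fstF_mem_FP sndF_mem_FP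

/-- Value of the keep-last operation. [folklore] -/
theorem keepOpF_apply (w : List Bool) : keepOpF w = if sndF w = [] then fstF w else sndF w := by
  rw [keepOpF, iteFn_apply (b := decide (sndF w = [])) (by simp [isNilFn])]
  by_cases h : sndF w = [] <;> simp [h]

/-- Growth of the keep-last operation. [folklore] -/
theorem length_keepOpF_le (w : List Bool) : (keepOpF w).length ≤ (fstF w).length + (sndF w).length + 0 := by
  rw [keepOpF_apply]; split_ifs <;> omega

/-- **The scale brick** `etaOfF x = 1^{etaOf |x|}`: the keep-last fold of the scale pieces over
`η' = 0, …, |x|`, then the tail. [folklore] -/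
def etaOfF : List Bool → List Bool :=
  dropFn ∘ fanoutFn (fun _ => [true]) (sndPow 2 ∘ foldLoop keepOpF (clipF 2 etaPieceF) (X + 1) ∘
    fanoutFn (fun w => w) (fanoutFn (lenBinF ∘ List.cons true) fun _ => boolPair [] []))

/-- `etaOfF ∈ FP`. [folklore] -/
theorem etaOfF_mem_FP : etaOfF ∈ FP :=
  comp_mem_FP dropFn_mem_FP (fanoutFn_mem_FP (const_mem_FP _) (comp_mem_FP (sndPow_mem_FP 2) (comp_mem_FP
    (foldLoop_clipF_mem_FP 2 keepOpF_mem_FP length_keepOpF_le etaPieceF_mem_FP _)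
    (fanoutFn_mem_FP (PolyTimeComputable.id _) (fanoutFn_mem_FP (comp_mem_FP lenBinF_mem_FP (cons_mem_FP true)) (const_mem_FP _))))))

/-- The keep-last fold selects the value at `Nat.findGreatest`. [folklore] -/
theorem foldl_keepLast (P : ℕ → Prop) [DecidablePred P] (v : ℕ → List Bool) (hv : ∀ i, v i ≠ []) :
    ∀ m, (List.range (m + 1)).foldl (fun acc i => if (if P i then v i else []) = [] then acc else (if P i then v i else [])) [] =
      if P (Nat.findGreatest P m) then v (Nat.findGreatest P m) else []
  | 0 => by simp
  | m + 1 => by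
    rw [List.range_succ, List.foldl_append, List.foldl_cons, List.foldl_nil, foldl_keepLast P v hv m, Nat.findGreatest_succ]
    by_cases h : P (m + 1)
    · simp [h, hv]
    · simp [h]

/-- **Value of the scale brick.** [folklore] -/
theorem etaOfF_apply (x : List Bool) : etaOfF x = ones (MildHard.etaOf x.length) := by
  have hk : x.length + 1 ≤ (X + 1 : Polynomial ℕ).eval x.length := by simp
  have hloop := foldLoop_apply keepOpF (clipF 2 etaPieceF) hk 0 []
  rw [show ones 0 = ([] : List Bool) from rfl] at hloop
  simp only [etaOfF, Function.comp_apply, fanoutFn_apply, lenBinF_apply, List.length_cons, dropFn_boolPair]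
  rw [hloop, sndPow_succ_boolPair, sndPow_succ_boolPair, sndPow_zero_boolPair, foldAcc_clipF (fun j _ hj => by
    rw [etaPieceF_apply]
    split_ifs
    · simp [ones]; omega
    · simp)]
  rw [foldAcc_eq_foldl keepOpF etaPieceF x (fun a b => if b = [] then a else b)
    (fun η' => if MildHard.lenOf η' ≤ x.length then true :: ones η' else []) _ _ _
    (fun a j _ _ => by rw [keepOpF_apply, fstF_boolPair, sndF_boolPair]) (fun j _ _ => etaPieceF_apply x j),
    ← List.range_eq_range', foldl_keepLast (fun η' => MildHard.lenOf η' ≤ x.length) (fun η' => true :: ones η') (by simp),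
    MildHard.etaOf]
  split_ifs with h
  · simp [ones]
  · -- no scale fits: then `findGreatest = 0`, and `[]` is `1⁰`
    have h0 : Nat.findGreatest (fun η => MildHard.lenOf η ≤ x.length) x.length = 0 := by
      rw [Nat.findGreatest_eq_zero_iff]
      intro n _ hn hPn
      exact h (Nat.findGreatest_spec (P := fun η => MildHard.lenOf η ≤ x.length) hn hPn)
    rw [h0]; simp [ones]

/-! #### The parameter bricks on `⟨x, P⟩` (payload and pad) -/

variable (e : List Bool) (Q : Polynomial ℕ)

/-- `1^η`, `η = etaOf |x|`. [folklore] -/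
def cEta : List Bool → List Bool := etaOfF ∘ fstF
/-- `1^{M+1}`, `M + 1 = 2η + 2`. [folklore] -/
def cM1 : List Bool → List Bool := (fun w => w ++ [true, true]) ∘ appF ∘ fanoutFn cEta cEta
/-- `1ᵏ`, `k = 2^η` (capped at `|x|`). [folklore] -/
def cK : List Bool → List Bool := binToUnaryFn ∘ fanoutFn fstF ((fun w => Kannan.zerosFn w ++ [true]) ∘ cEta)
/-- The modulus `f_M` (found by search, the pad paying for it). [folklore] -/
def cF : List Bool → List Bool := modSearchF ∘ fanoutFn cM1 sndF
/-- `1^{k(M+1)}`. [folklore] -/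
def cZL : List Bool → List Bool := umulF ∘ fanoutFn cK cM1
/-- The point part `Z = x[0, k(M+1))`. [folklore] -/
def cZ : List Bool → List Bool := takeFn ∘ fanoutFn cZL fstF
/-- The selector part `r = x[k(M+1), k(M+1) + M + 1)`. [folklore] -/
def cR : List Bool → List Bool := takeFn ∘ fanoutFn cM1 (dropFn ∘ fanoutFn cZL fstF)
/-- `1ⁿ`, `n = kη`. [folklore] -/
def cN : List Bool → List Bool := umulF ∘ fanoutFn cK cEta
/-- The environment `⟨f, ⟨1^η, ⟨1ᵏ, []⟩⟩⟩`. [folklore] -/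
def cEnv : List Bool → List Bool := fanoutFn cF (fanoutFn cEta (fanoutFn cK fun _ => []))
/-- The bits of the extension `P(z)`. [folklore] -/
def cE : List Bool → List Bool := extF e Q ∘ fanoutFn (fanoutFn cZ cEnv) (fanoutFn cN sndF)
/-- The validity bit `[lenOf η ≤ |x|]`. [folklore] -/
def cValid : List Bool → List Bool := notFn (ltFn ∘ fanoutFn (lenBinF ∘ fstF) (lenNumF ∘ fanoutFn fstF cEta))

/-- The parameter bricks are in `FP`. [folklore] -/
theorem cBricks_mem_FP : cEta ∈ FP ∧ cM1 ∈ FP ∧ cK ∈ FP ∧ cF ∈ FP ∧ cZL ∈ FP ∧ cZ ∈ FP ∧ cR ∈ FP ∧ cN ∈ FP ∧ cEnv ∈ FP ∧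
    cE e Q ∈ FP ∧ cValid ∈ FP := by
  have hEta : cEta ∈ FP := comp_mem_FP etaOfF_mem_FP fstF_mem_FP
  have hM1 : cM1 ∈ FP := comp_mem_FP (append_mem_FP (PolyTimeComputable.id _) (const_mem_FP _))
    (comp_mem_FP appF_mem_FP (fanoutFn_mem_FP hEta hEta))
  have hK : cK ∈ FP := comp_mem_FP binToUnaryFn_mem_FP (fanoutFn_mem_FP fstF_mem_FP
    (comp_mem_FP (append_mem_FP Kannan.zerosFn_mem_FP (const_mem_FP _)) hEta))
  have hF : cF ∈ FP := comp_mem_FP modSearchF_mem_FP (fanoutFn_mem_FP hM1 sndF_mem_FP)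
  have hZL : cZL ∈ FP := comp_mem_FP umulF_mem_FP (fanoutFn_mem_FP hK hM1)
  have hZ : cZ ∈ FP := comp_mem_FP takeFn_mem_FP (fanoutFn_mem_FP hZL fstF_mem_FP)
  have hR : cR ∈ FP := comp_mem_FP takeFn_mem_FP (fanoutFn_mem_FP hM1 (comp_mem_FP dropFn_mem_FP (fanoutFn_mem_FP hZL fstF_mem_FP)))
  have hN : cN ∈ FP := comp_mem_FP umulF_mem_FP (fanoutFn_mem_FP hK hEta)
  have hEnv : cEnv ∈ FP := fanoutFn_mem_FP hF (fanoutFn_mem_FP hEta (fanoutFn_mem_FP hK (const_mem_FP _)))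
  have hE : cE e Q ∈ FP := comp_mem_FP (extF_mem_FP e Q) (fanoutFn_mem_FP (fanoutFn_mem_FP hZ hEnv) (fanoutFn_mem_FP hN sndF_mem_FP))
  have hV : cValid ∈ FP := notFn_mem_FP (comp_mem_FP ltFn_mem_FP (fanoutFn_mem_FP (comp_mem_FP lenBinF_mem_FP fstF_mem_FP)
    (comp_mem_FP lenNumF_mem_FP (fanoutFn_mem_FP fstF_mem_FP hEta))))
  exact ⟨hEta, hM1, hK, hF, hZL, hZ, hR, hN, hEnv, hE, hV⟩

/-- **Values of the parameter bricks** at a valid scale (`lenOf η ≤ |x|`, `η = etaOf |x|`, pad `1ᴺ`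
with `N ≥ 2^{|x|}`). [folklore] -/
theorem cBricks_apply (x : List Bool) {N : ℕ} (hN : 2 ^ x.length ≤ N) {η : ℕ} (hη : MildHard.etaOf x.length = η)
    (hlen : MildHard.lenOf η ≤ x.length) :
    cEta (boolPair x (ones N)) = ones η ∧
    cM1 (boolPair x (ones N)) = ones (MildHard.MOf η + 1) ∧
    cK (boolPair x (ones N)) = ones (MildHard.kOf η) ∧
    cF (boolPair x (ones N)) = modStr (MildHard.MOf η) ∧
    cZL (boolPair x (ones N)) = ones (MildHard.kOf η * (MildHard.MOf η + 1)) ∧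
    cZ (boolPair x (ones N)) = x.take (MildHard.kOf η * (MildHard.MOf η + 1)) ∧
    cR (boolPair x (ones N)) = (x.drop (MildHard.kOf η * (MildHard.MOf η + 1))).take (MildHard.MOf η + 1) ∧
    cN (boolPair x (ones N)) = ones (MildHard.kOf η * η) ∧
    cEnv (boolPair x (ones N)) = env η (MildHard.kOf η) (modStr (MildHard.MOf η)) [] ∧
    cValid (boolPair x (ones N)) = [true] := by
  have hEta : cEta (boolPair x (ones N)) = ones η := by rw [cEta, Function.comp_apply, fstF_boolPair, etaOfF_apply, hη]
  have hM1 : cM1 (boolPair x (ones N)) = ones (MildHard.MOf η + 1) := by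
    simp only [cM1, Function.comp_apply, fanoutFn_apply, hEta, appF_boolPair, ones, MildHard.MOf_succ]
    rw [← List.replicate_add, show [true, true] = List.replicate 2 true from rfl, ← List.replicate_add]; ring_nf
  have hklen : MildHard.kOf η ≤ x.length := by
    have : MildHard.kOf η ≤ MildHard.lenOf η := by unfold MildHard.lenOf; nlinarith [Nat.zero_le (MildHard.kOf η)]
    omega
  have hK : cK (boolPair x (ones N)) = ones (MildHard.kOf η) := by
    simp only [cK, Function.comp_apply, fanoutFn_apply, hEta, fstF_boolPair, Kannan.zerosFn_apply, ones, List.length_replicate,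
      binToUnaryFn_boolPair, bitsToNat_zeros_append_true, MildHard.kOf]
    rw [min_eq_left (by unfold MildHard.kOf at hklen; exact hklen)]
  have hMlen : 2 * η + 2 ≤ x.length := by
    have : MildHard.MOf η + 1 ≤ MildHard.lenOf η := by unfold MildHard.lenOf; omega
    rw [MildHard.MOf_succ] at this; omega
  have hfuel : 2 ^ (MildHard.MOf η + 1) ≤ (ones N).length := by
    rw [MildHard.MOf_succ, ones, List.length_replicate]
    exact le_trans (Nat.pow_le_pow_right (by norm_num) hMlen) hN
  have hF : cF (boolPair x (ones N)) = modStr (MildHard.MOf η) := by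
    rw [cF, Function.comp_apply, fanoutFn_apply, hM1, sndF_boolPair]
    exact modSearchF_apply _ _ hfuel
  have hZL : cZL (boolPair x (ones N)) = ones (MildHard.kOf η * (MildHard.MOf η + 1)) := by
    rw [cZL, Function.comp_apply, fanoutFn_apply, hK, hM1, umulF_apply]
  have hZ : cZ (boolPair x (ones N)) = x.take (MildHard.kOf η * (MildHard.MOf η + 1)) := by
    rw [cZ, Function.comp_apply, fanoutFn_apply, hZL, fstF_boolPair, takeFn_boolPair, ones, List.length_replicate]
  have hR : cR (boolPair x (ones N)) = (x.drop (MildHard.kOf η * (MildHard.MOf η + 1))).take (MildHard.MOf η + 1) := by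
    simp only [cR, Function.comp_apply, fanoutFn_apply, hM1, hZL, fstF_boolPair, dropFn_boolPair, takeFn_boolPair, ones,
      List.length_replicate]
  have hNn : cN (boolPair x (ones N)) = ones (MildHard.kOf η * η) := by
    rw [cN, Function.comp_apply, fanoutFn_apply, hK, hEta, umulF_apply]
  have hEnv : cEnv (boolPair x (ones N)) = env η (MildHard.kOf η) (modStr (MildHard.MOf η)) [] := by
    simp only [cEnv, fanoutFn_apply, hF, hEta, hK, env]
  have hV : cValid (boolPair x (ones N)) = [true] := by
    rw [cValid]
    refine notFn_apply (b := false) ?_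
    simp only [Function.comp_apply, fanoutFn_apply, fstF_boolPair, lenBinF_apply, hEta, lenNumF_apply, ltFn_boolPair,
      bitsToNat_encodeNat]
    simp [not_lt.2 hlen]
  exact ⟨hEta, hM1, hK, hF, hZL, hZ, hR, hNn, hEnv, hV⟩

/-! #### Counting and selecting by the one-hot index -/

/-- The indicator piece on `⟨r, 1ˡ⟩`: `[1]` if `r[l]`, else `[]`. [folklore] -/
def onesPieceF : List Bool → List Bool :=
  iteFn (HashBricks.headBitFn ∘ bitAtFn ∘ fanoutFn sndF fstF) (fun _ => [true]) fun _ => []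

/-- `onesPieceF ∈ FP`. [folklore] -/
theorem onesPieceF_mem_FP : onesPieceF ∈ FP :=
  iteFn_mem_FP (comp_mem_FP HashBricks.headBitFn_mem_FP (comp_mem_FP bitAtFn_mem_FP (fanoutFn_mem_FP sndF_mem_FP fstF_mem_FP)))
    (const_mem_FP _) (const_mem_FP _)

/-- Value of the indicator piece. [folklore] -/
theorem onesPieceF_apply (r : List Bool) (l : ℕ) : onesPieceF (boolPair r (ones l)) = if r.getD l false then [true] else [] := by
  rw [onesPieceF, iteFn_apply (b := r.getD l false) (by simp [ones, List.getD_eq_getElem?_getD])]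

/-- **Counting the ones in unary**: `onesCountF r = 1^{#{l | r[l]}}`. [folklore] -/
def onesCountF : List Bool → List Bool :=
  sndPow 2 ∘ foldLoop appF (clipF 1 onesPieceF) X ∘ fanoutFn (fun w => w) (fanoutFn lenBinF fun _ => boolPair [] [])

/-- `onesCountF ∈ FP`. [folklore] -/
theorem onesCountF_mem_FP : onesCountF ∈ FP :=
  comp_mem_FP (sndPow_mem_FP 2) (comp_mem_FP (foldLoop_clipF_mem_FP 1 appF_mem_FP length_appF_le onesPieceF_mem_FP _)
    (fanoutFn_mem_FP (PolyTimeComputable.id _) (fanoutFn_mem_FP lenBinF_mem_FP (const_mem_FP _))))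

/-- Concatenated indicators are a unary count. [folklore] -/
theorem ccat_indicator (p : ℕ → Bool) : ∀ n, ccat (fun l => if p l then [true] else []) n =
    ones ((Finset.range n).filter fun l => p l = true).card
  | 0 => by simp [ones]
  | n + 1 => by
    rw [ccat_succ, ccat_indicator p n, Finset.range_add_one, Finset.filter_insert]
    by_cases h : p n = true
    · rw [if_pos h, if_pos h, Finset.card_insert_of_notMem (by simp), ones, ones, List.replicate_succ']
    · rw [if_neg h, if_neg h, List.append_nil]

/-- **Value of the unary count.** [folklore] -/
theorem onesCountF_apply (r : List Bool) :
    onesCountF r = ones ((Finset.range r.length).filter fun l => r.getD l false = true).card := by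
  have hk : r.length ≤ (X : Polynomial ℕ).eval r.length := by simp
  have hloop := foldLoop_apply appF (clipF 1 onesPieceF) hk 0 []
  rw [show ones 0 = ([] : List Bool) from rfl] at hloop
  simp only [onesCountF, Function.comp_apply, fanoutFn_apply, lenBinF_apply]
  rw [hloop, sndPow_succ_boolPair, sndPow_succ_boolPair, sndPow_zero_boolPair,
    foldAcc_clipF (fun j _ _ => by rw [onesPieceF_apply]; split_ifs <;> simp), foldAcc_appF]
  simp only [List.nil_append, zero_add, onesPieceF_apply]
  exact ccat_indicator _ _

/-- The joint indicator piece on `⟨⟨r, E⟩, 1ˡ⟩`: `[1]` if `r[l] ∧ E[l]`, else `[]`. [folklore] -/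
def selPieceF : List Bool → List Bool :=
  iteFn (andFn (HashBricks.headBitFn ∘ bitAtFn ∘ fanoutFn sndF (fstF ∘ fstF))
      (HashBricks.headBitFn ∘ bitAtFn ∘ fanoutFn sndF (sndF ∘ fstF))) (fun _ => [true]) fun _ => []

/-- `selPieceF ∈ FP`. [folklore] -/
theorem selPieceF_mem_FP : selPieceF ∈ FP :=
  iteFn_mem_FP (andFn_mem_FP
      (comp_mem_FP HashBricks.headBitFn_mem_FP (comp_mem_FP bitAtFn_mem_FP (fanoutFn_mem_FP sndF_mem_FP (comp_mem_FP fstF_mem_FP fstF_mem_FP))))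
      (comp_mem_FP HashBricks.headBitFn_mem_FP (comp_mem_FP bitAtFn_mem_FP (fanoutFn_mem_FP sndF_mem_FP (comp_mem_FP sndF_mem_FP fstF_mem_FP)))))
    (const_mem_FP _) (const_mem_FP _)

/-- Value of the joint indicator piece. [folklore] -/
theorem selPieceF_apply (r E : List Bool) (l : ℕ) :
    selPieceF (boolPair (boolPair r E) (ones l)) = if r.getD l false && E.getD l false then [true] else [] := by
  rw [selPieceF, iteFn_apply (b := r.getD l false && E.getD l false)
    (andFn_apply (by simp [ones, List.getD_eq_getElem?_getD]) (by simp [ones, List.getD_eq_getElem?_getD]))]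

/-- **Selecting in unary**: `selF ⟨r, E⟩ = 1^{#{l < |r| : r[l] ∧ E[l]}}`. [folklore] -/
def selF : List Bool → List Bool :=
  sndPow 2 ∘ foldLoop appF (clipF 1 selPieceF) X ∘ fanoutFn (fun w => w) (fanoutFn (lenBinF ∘ fstF) fun _ => boolPair [] [])

/-- `selF ∈ FP`. [folklore] -/
theorem selF_mem_FP : selF ∈ FP :=
  comp_mem_FP (sndPow_mem_FP 2) (comp_mem_FP (foldLoop_clipF_mem_FP 1 appF_mem_FP length_appF_le selPieceF_mem_FP _)
    (fanoutFn_mem_FP (PolyTimeComputable.id _) (fanoutFn_mem_FP (comp_mem_FP lenBinF_mem_FP fstF_mem_FP) (const_mem_FP _))))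

/-- **Value of the unary selection.** [folklore] -/
theorem selF_apply (r E : List Bool) :
    selF (boolPair r E) = ones ((Finset.range r.length).filter fun l => (r.getD l false && E.getD l false) = true).card := by
  have hk : r.length ≤ (X : Polynomial ℕ).eval (boolPair r E).length := by simp only [eval_X, length_boolPair]; omega
  have hloop := foldLoop_apply appF (clipF 1 selPieceF) hk 0 []
  rw [show ones 0 = ([] : List Bool) from rfl] at hloop
  simp only [selF, Function.comp_apply, fanoutFn_apply, lenBinF_apply, fstF_boolPair]
  rw [hloop, sndPow_succ_boolPair, sndPow_succ_boolPair, sndPow_zero_boolPair,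
    foldAcc_clipF (fun j _ _ => by rw [selPieceF_apply]; split_ifs <;> simp), foldAcc_appF]
  simp only [List.nil_append, zero_add, selPieceF_apply]
  exact ccat_indicator _ _

/-- **One-hot vectors are those with exactly one `1`.** [folklore] -/
theorem exists_eq_indic_iff {n : ℕ} (g : Fin (n + 1) → Bool) :
    (∃ l, g = SelfCorrect.indic l) ↔ (Finset.univ.filter fun l => g l = true).card = 1 := by
  constructor
  · rintro ⟨l, rfl⟩
    rw [Finset.card_eq_one]
    exact ⟨l, by ext l'; simp [SelfCorrect.indic]⟩
  · intro h
    obtain ⟨l, hl⟩ := Finset.card_eq_one.1 h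
    refine ⟨l, funext fun l' => ?_⟩
    have := Finset.ext_iff.1 hl l'
    simp only [Finset.mem_filter, Finset.mem_univ, true_and, Finset.mem_singleton] at this
    rw [SelfCorrect.indic]
    by_cases hg : g l' = true
    · rw [hg, eq_comm, decide_eq_true (this.1 hg)]
    · have hne : l' ≠ l := fun heq => hg (this.2 heq)
      simp only [Bool.not_eq_true] at hg
      rw [hg, eq_comm, decide_eq_false hne]

/-- Range counts are `Fin` counts. [folklore] -/
theorem card_range_filter_eq {n : ℕ} (p : ℕ → Prop) [DecidablePred p] :
    ((Finset.range n).filter p).card = (Finset.univ.filter fun l : Fin n => p l).card := by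
  rw [Finset.card_filter, Finset.card_filter, ← Fin.sum_univ_eq_sum_range (fun i => if p i then 1 else 0)]

/-! #### The core decision function and its value -/

/-- The validity bit in general. [folklore] -/
theorem cValid_apply (x P : List Bool) :
    cValid (boolPair x P) = [decide (MildHard.lenOf (MildHard.etaOf x.length) ≤ x.length)] := by
  rw [cValid]
  refine (notFn_apply (b := decide (x.length < MildHard.lenOf (MildHard.etaOf x.length))) ?_).trans ?_
  · simp only [Function.comp_apply, fanoutFn_apply, fstF_boolPair, lenBinF_apply, cEta, etaOfF_apply, lenNumF_apply, ltFn_boolPair,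
      bitsToNat_encodeNat]
  · rw [← decide_not, Bool.decide_congr not_lt]

/-- **The core decision function** on `⟨x, P⟩`: valid scale, one-hot selector, and the selected bit of `P(z)`. [folklore] -/
def coreF : List Bool → List Bool :=
  andFn cValid (andFn (eqPairFn ∘ fanoutFn (onesCountF ∘ cR) fun _ => [true])
    (notFn (isNilFn ∘ selF ∘ fanoutFn cR (cE e Q))))

/-- `coreF ∈ FP`. [folklore] -/
theorem coreF_mem_FP : coreF e Q ∈ FP := by
  obtain ⟨_, _, _, _, _, _, hR, _, _, hE, hV⟩ := cBricks_mem_FP e Q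
  exact andFn_mem_FP hV (andFn_mem_FP (comp_mem_FP eqPairFn_mem_FP (fanoutFn_mem_FP (comp_mem_FP onesCountF_mem_FP hR) (const_mem_FP _)))
    (notFn_mem_FP (comp_mem_FP isNilFn_mem_FP (comp_mem_FP selF_mem_FP (fanoutFn_mem_FP hR hE)))))

/-- The core decision function is one-bit on every input. [folklore] -/
theorem oneBit_coreF : OneBit (coreF e Q) :=
  oneBit_andFn (oneBit_notFn (oneBit_ltFn.comp _))
    (oneBit_andFn (fun w => by rcases eqPairFn_eq_or (fanoutFn (onesCountF ∘ cR) (fun _ => [true]) w) with h | h <;> exact ⟨_, h⟩)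
      (oneBit_notFn (oneBit_isNilFn.comp _)))

/-- The point read off `x` in blocks of `M + 1` bits. [folklore] -/
def zOfX (M k : ℕ) (x : List Bool) : Fin k → GF2 M := fun i => decF M fun l => x.getD ((l : ℕ) + (M + 1) * i) false

/-- `bits ∘ decF` lists the bits. [folklore] -/
theorem bits_decF (w : Fin (M + 1) → Bool) : bits M (decF M w) = List.ofFn w := by rw [bits, encF_decF]

/-- Lists of `k` windows of width `w` agreeing window by window are equal. [folklore] -/
theorem eq_of_windows_eq (w : ℕ) : ∀ (k : ℕ) (l l' : List Bool), l.length = k * w → l'.length = k * w →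
    (∀ r, r < k → (l.drop (w * r)).take w = (l'.drop (w * r)).take w) → l = l'
  | 0, l, l', hl, hl', _ => by
    rw [Nat.zero_mul, List.length_eq_zero_iff] at hl hl'; rw [hl, hl']
  | k + 1, l, l', hl, hl', h => by
    have h0 := h 0 (Nat.succ_pos k)
    simp only [mul_zero, List.drop_zero] at h0
    rw [← List.take_append_drop w l, ← List.take_append_drop w l', h0]
    congr 1
    refine eq_of_windows_eq w k _ _ (by rw [List.length_drop, hl, Nat.succ_mul]; omega)
      (by rw [List.length_drop, hl', Nat.succ_mul]; omega) fun r hr => ?_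
    have := h (r + 1) (by omega)
    simp only [List.drop_drop] at this ⊢
    rwa [Nat.mul_succ, Nat.add_comm (w * r) w] at this

/-- A window of `x` as a list of reads. [folklore] -/
theorem take_drop_eq_ofFn {x : List Bool} {w s : ℕ} (h : s + w ≤ x.length) :
    (x.drop s).take w = List.ofFn fun l : Fin w => x.getD (s + l) false := by
  apply List.ext_getElem
  · simp; omega
  · intro i h1 h2
    rw [List.getElem_take, List.getElem_drop, List.getElem_ofFn, List.getD_eq_getElem _ _ (by simp at h2; omega)]

/-- **The flattened blocks of the point read off `x` are the prefix of `x`.** [folklore] -/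
theorem zFlat_zOfX (M k : ℕ) (x : List Bool) (h : k * (M + 1) ≤ x.length) :
    zFlat M k (zOfX M k x) = x.take (k * (M + 1)) := by
  refine eq_of_windows_eq (M + 1) k _ _ (length_zFlat M k _) (by rw [List.length_take]; exact min_eq_left h) fun r hr => ?_
  rw [take_drop_zFlat M k _ r hr, zOfX, bits_decF]
  have h1 : (M + 1) * (r + 1) ≤ k * (M + 1) := by rw [mul_comm]; exact Nat.mul_le_mul_right _ hr
  rw [List.drop_take, List.take_take, min_eq_left (by rw [Nat.mul_succ] at h1; omega),
    take_drop_eq_ofFn (by rw [Nat.mul_succ] at h1; omega)]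
  congr 1; funext l; congr 1; ring

/-- Reads of the selector window. [folklore] -/
theorem getD_take_drop {x : List Bool} {K w l : ℕ} (hl : l < w) : ((x.drop K).take w).getD l false = x.getD (K + l) false := by
  rw [List.getD_eq_getElem?_getD, List.getD_eq_getElem?_getD, List.getElem?_take, if_pos hl, List.getElem?_drop]

/-- Positions of the point part. [folklore] -/
theorem idx_inl_val (η : ℕ) (i : Fin (MildHard.kOf η)) (l : Fin (MildHard.MOf η + 1)) :
    ((MildHard.idx η (Sum.inl (i, l)) : Fin (MildHard.lenOf η)) : ℕ) = (l : ℕ) + (MildHard.MOf η + 1) * i := by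
  have : MildHard.idx η (Sum.inl (i, l)) = Fin.castAdd _ (finProdFinEquiv (i, l)) := rfl
  rw [this, Fin.val_castAdd, finProdFinEquiv_apply_val]

/-- Positions of the selector part. [folklore] -/
theorem idx_inr_val (η : ℕ) (l : Fin (MildHard.MOf η + 1)) :
    ((MildHard.idx η (Sum.inr l) : Fin (MildHard.lenOf η)) : ℕ) = MildHard.kOf η * (MildHard.MOf η + 1) + l := by
  have : MildHard.idx η (Sum.inr l) = Fin.natAdd _ l := rfl
  rw [this, Fin.val_natAdd]

/-- The source function is the cube function of the language's indicator. [folklore] -/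
theorem srcFn_eq_cubeFnOf (L : Language Bool) (η : ℕ) :
    MildHard.srcFn L η = cubeFnOf η (MildHard.kOf η) L.boolIndicator := by
  funext a; rfl

/-- Reading a coordinate off `bits`. [folklore] -/
theorem getD_bits (u : GF2 M) (l : Fin (M + 1)) : (bits M u).getD l false = encF M u l := by
  rw [bits, List.getD_eq_getElem _ _ (by rw [List.length_ofFn]; exact l.isLt), List.getElem_ofFn]

/-- The Boolean bookkeeping of the one-hot selection: "exactly one selector bit, and it selects a `1`"
is the selected bit of a one-hot selector, and `0` otherwise. [folklore] -/
theorem onehot_select_eq {n : ℕ} (rFun g : Fin (n + 1) → Bool) :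
    (decide ((Finset.univ.filter fun l => rFun l = true).card = 1) &&
      !decide ((Finset.univ.filter fun l => (rFun l && g l) = true).card = 0)) =
      (if h : ∃ l, rFun = SelfCorrect.indic l then g h.choose else false) := by
  by_cases hex : ∃ l : Fin (n + 1), rFun = SelfCorrect.indic l
  · obtain ⟨l, hl⟩ := hex
    have hex' : ∃ l₀ : Fin (n + 1), rFun = SelfCorrect.indic l₀ := ⟨l, hl⟩
    rw [dif_pos hex']
    have hchoose : hex'.choose = l := SelfCorrect.indic_injective (hex'.choose_spec.symm.trans hl)
    rw [hchoose, (exists_eq_indic_iff _).1 ⟨l, hl⟩]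
    have hfilter : (Finset.univ.filter fun l' : Fin (n + 1) => (rFun l' && g l') = true) = if g l = true then {l} else ∅ := by
      ext l'
      have hrl : rFun l' = SelfCorrect.indic l l' := congrFun hl l'
      simp only [Finset.mem_filter, Finset.mem_univ, true_and, hrl, SelfCorrect.indic, Bool.and_eq_true, decide_eq_true_eq]
      split_ifs with hb
      · simp only [Finset.mem_singleton]
        constructor
        · exact fun h => h.1
        · rintro rfl; exact ⟨rfl, hb⟩
      · simp only [Finset.notMem_empty, iff_false, not_and]
        rintro rfl; exact hb
    rw [hfilter]
    cases g l <;> simp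
  · rw [dif_neg hex]
    have : (Finset.univ.filter fun l : Fin (n + 1) => rFun l = true).card ≠ 1 := fun h => hex ((exists_eq_indic_iff _).2 h)
    simp [this]

/-- **Value of the core decision function: the hard bit.** For a pad `1ᴺ` with `N ≥ 2^{|x|}` and an
oracle answering membership in `L` within budget `Q(N)` on all strings of length `≤ |x|`.
[cite: AroraBarakCC2009, Thm. 19.21 (proof: `E` is closed under the encoding)] -/
theorem coreF_apply (L : Language Bool) (x : List Bool) {N : ℕ} (hN : 2 ^ x.length ≤ N)
    (hrun : ∀ u : List Bool, u.length ≤ x.length → ClockedUS.run (boolPair e u) (Q.eval N) = some [L.boolIndicator u]) :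
    coreF e Q (boolPair x (ones N)) = [MildHard.hardBit L x] := by
  -- the three bits
  rw [coreF, andFn_apply (cValid_apply x (ones N)) (andFn_apply
    (b := decide (onesCountF (cR (boolPair x (ones N))) = [true]))
    (b' := !decide (selF (boolPair (cR (boolPair x (ones N))) (cE e Q (boolPair x (ones N)))) = []))
    (by simp only [Function.comp_apply, fanoutFn_apply, eqPairFn_boolPair])
    (notFn_apply (by simp only [Function.comp_apply, fanoutFn_apply, isNilFn])))]
  by_cases hlen : MildHard.lenOf (MildHard.etaOf x.length) ≤ x.length
  swap
  · -- invalid scale: the hard bit is `0`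
    rw [decide_eq_false hlen, Bool.false_and, MildHard.hardBit, dif_neg hlen]
  rw [decide_eq_true hlen, Bool.true_and]
  set η := MildHard.etaOf x.length with hη
  obtain ⟨hEta, hM1, hK, hF, hZL, hZ, hR, hNn, hEnv, -⟩ := cBricks_apply x hN hη.symm hlen
  have hK' : MildHard.kOf η * (MildHard.MOf η + 1) + (MildHard.MOf η + 1) ≤ x.length := by
    have : MildHard.lenOf η = MildHard.kOf η * (MildHard.MOf η + 1) + (MildHard.MOf η + 1) := rfl
    omega
  have hM1pos : 1 ≤ MildHard.MOf η := by unfold MildHard.MOf; omega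
  have hηM : η ≤ MildHard.MOf η + 1 := by unfold MildHard.MOf; omega
  have hkη : 2 ^ η ≤ MildHard.kOf η := le_of_eq rfl
  have hnm : MildHard.kOf η * η ≤ x.length := by
    have : MildHard.kOf η * η ≤ MildHard.kOf η * (MildHard.MOf η + 1) := Nat.mul_le_mul_left _ hηM
    omega
  -- the bits of the extension
  have hE : cE e Q (boolPair x (ones N)) =
      bits (MildHard.MOf η) (SelfCorrect.ext (cubeFnOf η (MildHard.kOf η) L.boolIndicator) (zOfX (MildHard.MOf η) (MildHard.kOf η) x)) := by
    rw [cE, Function.comp_apply, fanoutFn_apply, fanoutFn_apply, fanoutFn_apply, hZ, hEnv, hNn, sndF_boolPair,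
      ← zFlat_zOfX (MildHard.MOf η) (MildHard.kOf η) x (by omega)]
    exact extF_apply (MildHard.MOf η) η (MildHard.kOf η) e Q hM1pos hηM hkη _ [] (le_trans (Nat.pow_le_pow_right (by norm_num) hnm) hN)
      L.boolIndicator (fun u hu => hrun u (by omega))
  -- the selector window and its reads
  have hrlen : ((x.drop (MildHard.kOf η * (MildHard.MOf η + 1))).take (MildHard.MOf η + 1)).length = MildHard.MOf η + 1 := by
    rw [List.length_take, List.length_drop]; omega
  rw [hR, hE, onesCountF_apply, selF_apply, hrlen, MildHard.hardBit_eq L x rfl hη.symm hlen, SelfCorrect.hardFn]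
  -- identify the selector function and the point of the definition
  have hsel : (fun l' : Fin (MildHard.MOf η + 1) => x.getD (MildHard.idx η (Sum.inr l')) false) =
      fun l' : Fin (MildHard.MOf η + 1) => ((x.drop (MildHard.kOf η * (MildHard.MOf η + 1))).take (MildHard.MOf η + 1)).getD l' false := by
    funext l'; rw [getD_take_drop l'.isLt, idx_inr_val]
  have hpt : SelfCorrect.zOf (fun q => x.getD (MildHard.idx η q) false) = zOfX (MildHard.MOf η) (MildHard.kOf η) x := by
    funext i; simp only [SelfCorrect.zOf, zOfX, idx_inl_val]
  simp only [hsel, hpt, srcFn_eq_cubeFnOf, card_range_filter_eq]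
  -- the remaining Boolean bookkeeping
  have hones1 : ∀ c : ℕ, (ones c = [true]) ↔ c = 1 := fun c => by
    constructor
    · intro h; have := congrArg List.length h; simpa [ones] using this
    · rintro rfl; rfl
  have hones0 : ∀ c : ℕ, (ones c = []) ↔ c = 0 := fun c => by simp [ones]
  simp only [hones1, hones0, getD_bits]
  rw [onehot_select_eq]

/-! ### B10. The padded language is in `P`; B11. the language is in `E` -/

/-- **The decision function on the padded input** `1^{2^{|x|}} 0 x`: read the pad and the payload, run the core. [folklore] -/
def topF : List Bool → List Bool := coreF e Q ∘ fanoutFn restT.eval padT.eval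

/-- `topF ∈ FP`. [folklore] -/
theorem topF_mem_FP : topF e Q ∈ FP :=
  comp_mem_FP (coreF_mem_FP e Q) (fanoutFn_mem_FP restT.polyTimeComputable_eval padT.polyTimeComputable_eval)

/-- **Value on a padded input.** [folklore] -/
theorem topF_expPad (L : Language Bool) (x : List Bool)
    (hrun : ∀ u : List Bool, u.length ≤ x.length → ClockedUS.run (boolPair e u) (Q.eval (2 ^ x.length)) = some [L.boolIndicator u]) :
    topF e Q (expPad 1 x) = [MildHard.hardBit L x] := by
  have hw : expPad 1 x = ones (2 ^ x.length) ++ false :: x := by simp [expPad, ones]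
  rw [topF, Function.comp_apply, fanoutFn_apply, hw, restT_eval, padT_eval]
  exact coreF_apply e Q L x le_rfl hrun

/-- **The padded hard language** decided by `topF`. [folklore] -/
def hardLangPad : Language Bool := {w | topF e Q w = [true]}

/-- The padded hard language is in `P`. [cite: AroraBarakCC2009, Thm. 19.21 (proof)] -/
theorem hardLangPad_mem_P : hardLangPad e Q ∈ Classes.P := by
  refine mem_P_of_mem_FP (topF_mem_FP e Q) _ fun w => ⟨fun h => h, fun h => ?_⟩
  obtain ⟨b, hb⟩ : ∃ b, topF e Q w = [b] := (oneBit_coreF e Q).comp _ w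
  cases b with
  | true => exact absurd hb h
  | false => exact hb

/-- **Padding**: `x ∈ hardLang L ↔ expPad 1 x ∈ hardLangPad` when the coded machine `e` answers
membership in `L` within budget `Q(2^{|x|})` on strings of length `≤ |x|`. [folklore] -/
theorem mem_hardLang_iff (L : Language Bool)
    (hrun : ∀ (x u : List Bool), u.length ≤ x.length → ClockedUS.run (boolPair e u) (Q.eval (2 ^ x.length)) = some [L.boolIndicator u])
    (x : List Bool) : x ∈ MildHard.hardLang L ↔ expPad 1 x ∈ hardLangPad e Q := by
  change MildHard.hardBit L x = true ↔ topF e Q (expPad 1 x) = [true]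
  rw [topF_expPad e Q L x (hrun x)]
  simp

/-- Arithmetic of the translation: `C 2ⁿ + C + (c (2 · 2ⁿ)ʲ + c) ≤ c' 2^{(j+1) n} + c'`. [folklore] -/
theorem translation_bound (C c j : ℕ) : ∃ c' : ℕ, ∀ n : ℕ,
    C * 2 ^ (n ^ 1) + C + (c * (2 * 2 ^ (n ^ 1)) ^ j + c) ≤ c' * 2 ^ ((j + 1) * n) + c' := by
  refine ⟨C + c * 2 ^ j + c, fun n => ?_⟩
  rw [pow_one]
  have h1 : 2 ^ n ≤ 2 ^ ((j + 1) * n) := Nat.pow_le_pow_right (by norm_num) (by nlinarith)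
  have h2 : (2 * 2 ^ n) ^ j = 2 ^ j * 2 ^ (n * j) := by rw [mul_pow, ← pow_mul]
  have h3 : 2 ^ (n * j) ≤ 2 ^ ((j + 1) * n) := Nat.pow_le_pow_right (by norm_num) (by nlinarith)
  rw [h2]
  have h4 := Nat.mul_le_mul_left C h1
  have h5 := Nat.mul_le_mul_left (c * 2 ^ j) h3
  set X := 2 ^ ((j + 1) * n) with hX
  calc C * 2 ^ n + C + (c * (2 ^ j * 2 ^ (n * j)) + c)
      = C * 2 ^ n + c * 2 ^ j * 2 ^ (n * j) + (C + c) := by ring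
    _ ≤ C * X + c * 2 ^ j * X + (C + c * 2 ^ j + c) := by omega
    _ ≤ (C + c * 2 ^ j + c) * X + (C + c * 2 ^ j + c) := by nlinarith [Nat.zero_le (c * X)]

/-- **The mildly hard language of a language in `E` is in `E`** (Arora–Barak 2009, proof of
Thm. 19.21: "`E` is closed under such encodings": the extension is a sum of `2ⁿ` terms, each a
product of polynomially many field operations, and the field of size `poly(n)` is found by search;
here: the padded language is in `P` by the machine `topF`, and upward translation
`ExpPadding.exists_timeDecidable_of_expPad` with a linear-exponential pad).
[cite: AroraBarakCC2009, Thm. 19.21 (proof)] -/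
theorem hardLang_mem_E {L : Language Bool} (hL : L ∈ E) : MildHard.hardLang L ∈ E := by
  classical
  obtain ⟨e, Q, hrun⟩ := NWMachine.exists_run_of_mem_E hL 1
  have hrun' : ∀ (x u : List Bool), u.length ≤ x.length →
      ClockedUS.run (boolPair e u) (Q.eval (2 ^ x.length)) = some [L.boolIndicator u] := by
    intro x u hu
    refine hrun (2 ^ x.length) u ?_
    rw [one_mul, NWMachine.tOf, Nat.log_pow (by norm_num)]
    omega
  have hP := hardLangPad_mem_P e Q
  simp only [Classes.P, Set.mem_iUnion] at hP
  obtain ⟨j, c, hc⟩ := hP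
  have hmono : Monotone fun n : ℕ => c * n ^ j + c := fun a b hab => by
    simp only
    exact Nat.add_le_add_right (Nat.mul_le_mul_left c (Nat.pow_le_pow_left hab j)) c
  obtain ⟨C, hC⟩ := exists_timeDecidable_of_expPad (k := 1) le_rfl hmono (mem_hardLang_iff e Q L hrun') hc
  obtain ⟨c', hc'⟩ := translation_bound C c j
  obtain ⟨M, hM⟩ := hC
  simp only [E, Set.mem_iUnion]
  exact ⟨j + 1, c', M, hM.mono fun x => hc' x.length⟩

/-- **From worst-case to mild average-case hardness inside `E`, almost everywhere**: if some
`L ∈ E` needs circuits of size `2^{εn}` at all large lengths `n`, then some `L₁ ∈ E` (namely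
`hardLang L`) is mildly hard on average at all large lengths: every `B₂`-circuit of size
`≤ 2^{εm/16}` errs on at least `2ᵐ/m⁶` of the inputs of length `m` (Babai–Fortnow–Nisan–Wigderson
1993, §4; Arora–Barak 2009, Thm. 19.21, very mild regime; `MildHard.mild_of_worst` + `hardLang_mem_E`).
[cite: AroraBarakCC2009, Thm. 19.21] -/
theorem exists_mildHard_E
    (h : ∃ L ∈ E, ∃ ε : ℝ, 0 < ε ∧ ∀ᶠ n : ℕ in Filter.atTop, (2 : ℝ) ^ (ε * n) ≤ (L.circuitSize n : ℝ)) :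
    ∃ L₁ ∈ E, ∃ ε : ℝ, 0 < ε ∧ ∀ᶠ m : ℕ in Filter.atTop, ∀ C : Circuit (Fin m), C.IsOver B2 →
      (C.size : ℝ) ≤ (2 : ℝ) ^ (ε / 16 * m) →
        (2 : ℝ) ^ m ≤ (m : ℝ) ^ 6 * (Finset.univ.filter fun w : Fin m → Bool => C.eval w ≠ L₁.sliceFn m w).card := by
  obtain ⟨L, hL, ε, hε, hhard⟩ := h
  exact ⟨MildHard.hardLang L, hardLang_mem_E hL, ε, hε, MildHard.mild_of_worst L hε hhard⟩

end Top

end HardLangM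

end Literature.Computability.Complexity

end
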